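import Literature.NumberTheory.Sieve.QuadraticRootsTothReduction
import Literature.NumberTheory.Sieve.FriedlanderIwaniecPrimesSmoothCutoff
import Mathlib.Analysis.SpecialFunctions.Log.Deriv
import Mathlib.Analysis.Calculus.ContDiff.Bounds
import Mathlib.Analysis.Calculus.Deriv.ZPow
import Mathlib.Analysis.Calculus.IteratedDeriv.Lemmas
import HarnessLib

/-!
# The column function of the Tóth sums over `ℝ` and its derivative bounds

This module has two parts: (1) the column function, its support geometry and smoothness;
(2) the derivative and `L¹` bounds (Ngo's Lemmas 3.16–3.17/3.20 input for the Poisson step).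

## Part 1. The column function

Topic `Literature/NumberTheory/Sieve`, a support file for the Poisson step of Tóth's method
(T. Ngo, arXiv:2107.13301, §3.5): the hypothesis `HP` of
`…TothReduction.toth2000_quadraticRoots_primeModuli_of_tothPoincareBound` bounds the Tóth sums
`∑'_{v=(α,γ)} W_R(ξ_v) ψ_R(ξ_v)`.  For the Poisson summation in `γ` (for fixed `α = u ≠ 0`) one
needs the summand as a smooth compactly supported function of a REAL variable `t` interpolating
`γ`.  With the first-column quantities

* `colA R u t = A u² + B u t + C t² = A (u − tθ₊)(u − tθ₋)` (`= (R·ξ).a` at `(u,t) = (α,γ)`),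
* `colK R u t = (u − tθ₊)/(u − tθ₋)` (`= deckFactor R ξ`),
* `colPsi R L m u t = β(log|colK|/L − m)` (`= tothWeight R g₁ m ξ` for `L = log κ₁⁻¹`),
* `colPhi R b u t = (B u + 2C t)/(2u·colA) − b/(2 colA)` (the smooth part of the Hooley phase,
  `…TothWeylSum.weylPhase_factor`),

the **column function** is
`colFn R a b x Y₁ h L m u t = G_{x,Y₁}(colA/a) · e(h·colPhi) · colPsi` (and `0` where `colA = 0`).
This file proves that it is smooth in `t` (`contDiff_colFn`: near the two real zeros of
`colA(u,·)` the plateau factor vanishes identically) and the support geometry Ngo uses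
(§3.4 Lemma 3.11 (3), §3.5: "`c ≍ d ≍ √x`"): on the support `a x/2 < colA < 5ax/2`,
`e^{mL} < |colK| < e^{(m+2)L}`, hence `|u − tθ±| ≍ √x`, `|t|, |u| ≪ √x`
(`exists_colFn_support_consts`).

## References

* T. Ngo, *On roots of quadratic congruences*, arXiv:2107.13301, §3.4 Lemma 3.11, §3.5
  Lemmas 3.15–3.17. [cite: Ngo2024, §3.4 Lemma 3.11, §3.5 Lemma 3.15]
* Á. Tóth, *Roots of quadratic congruences*, IMRN 2000, 719–739. [cite: Toth2000, §4]
-/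

noncomputable section

namespace Literature.NumberTheory.Sieve

open scoped MatrixGroups
open Literature.NumberTheory.QuadraticFields.Quadratic (BinQF)

namespace RootForms

variable {R : BinQF}

/-! ### First-column quantities over `ℝ` -/

/-- `A'(u, t) = A u² + B u t + C t²`, the first coefficient of `R·ξ` as a function of a real
first column `(u, t)`. [cite: Ngo2024, §3.2 (the function `v(ξ)`)] -/
def colA (R : BinQF) (u t : ℝ) : ℝ := R.a * u ^ 2 + R.b * u * t + R.c * t ^ 2

/-- `A'(u,t) = A (u − tθ₊)(u − tθ₋)` (Vieta). [folklore] -/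
theorem colA_eq_mul (hA : R.a ≠ 0) (hΔ : 0 ≤ R.disc) (u t : ℝ) :
    colA R u t = R.a * ((u - t * rootPlus R) * (u - t * rootMinus R)) := by
  rw [colA]
  have hs := a_mul_root_sum hA
  have hp := a_mul_root_prod hA hΔ
  linear_combination (u * t) * hs - (t ^ 2) * hp

/-- At an integer column: `colA R α γ = (R·ξ).a`. [folklore] -/
theorem colA_col (R : BinQF) (g : SL(2, ℤ)) : colA R (g 0 0) (g 1 0) = (smul R g).a := by
  rw [colA, smul_a_cast]

/-- `colA` is smooth in `t`. [folklore] -/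
theorem contDiff_colA (R : BinQF) (u : ℝ) {n : ℕ∞} : ContDiff ℝ n (fun t => colA R u t) := by
  unfold colA; fun_prop

/-- `colA` is continuous in `t`. [folklore] -/
theorem continuous_colA (R : BinQF) (u : ℝ) : Continuous (fun t => colA R u t) := by
  unfold colA; fun_prop

/-- The transport factor `κ(u, t) = (u − tθ₊)/(u − tθ₋)` over `ℝ`. [cite: Ngo2024, §3.4 Definition 3.10] -/
def colK (R : BinQF) (u t : ℝ) : ℝ := (u - t * rootPlus R) / (u - t * rootMinus R)

/-- At an integer column: `colK R α γ = deckFactor R ξ`. [folklore] -/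
theorem colK_col (R : BinQF) (g : SL(2, ℤ)) : colK R (g 0 0) (g 1 0) = deckFactor R g := rfl

/-- Tóth's weight over `ℝ`: `ψ(u,t) = β(log|κ(u,t)|/L − m)`. [cite: Ngo2024, §3.4 Definition 3.10] -/
def colPsi (R : BinQF) (L : ℝ) (m : ℤ) (u t : ℝ) : ℝ :=
  unitPartition (Real.log |colK R u t| / L - m)

/-- At an integer column and `L = log κ₁⁻¹`: `colPsi = tothWeight`. [folklore] -/
theorem colPsi_col (R : BinQF) (g₁ : SL(2, ℤ)) (m : ℤ) (g : SL(2, ℤ)) :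
    colPsi R (Real.log (deckFactor R g₁)⁻¹) m (g 0 0) (g 1 0) = tothWeight R g₁ m g := by
  rw [colPsi, colK_col, tothWeight]

/-- `0 ≤ ψ ≤ 1`. [folklore] -/
theorem colPsi_nonneg (R : BinQF) (L : ℝ) (m : ℤ) (u t : ℝ) : 0 ≤ colPsi R L m u t :=
  unitPartition_nonneg _

/-- `0 ≤ ψ ≤ 1`. [folklore] -/
theorem colPsi_le_one (R : BinQF) (L : ℝ) (m : ℤ) (u t : ℝ) : colPsi R L m u t ≤ 1 :=
  unitPartition_le_one _

/-- The smooth part of the Hooley phase over `ℝ`: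
`Φ(u,t) = (B u + 2C t)/(2u·A'(u,t)) − b/(2A'(u,t))`. [cite: Ngo2024, §3.2 Lemma 3.2] -/
def colPhi (R : BinQF) (b : ℤ) (u t : ℝ) : ℝ :=
  (R.b * u + 2 * R.c * t) / (2 * u * colA R u t) - b / (2 * colA R u t)

/-- At an integer column `colPhi` is the second phase of `weylPhase_factor`. [folklore] -/
theorem colPhi_col (R : BinQF) (b : ℤ) (g : SL(2, ℤ)) :
    colPhi R b (g 0 0) (g 1 0) =
      ((R.b : ℝ) * g 0 0 + 2 * R.c * g 1 0) / (2 * (g 0 0 : ℝ) * (smul R g).a) -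
        b / (2 * (smul R g).a) := by
  rw [colPhi, colA_col]

/-- **The column function** of the Tóth sum: plateau × smooth Hooley phase × Tóth weight, as a
function of the real first column `(u, t)`; set to `0` on the two lines `colA = 0` (where the
plateau factor vanishes identically nearby anyway). [cite: Ngo2024, §3.5 Lemma 3.15 (the function `F`)] -/
def colFn (R : BinQF) (a b : ℤ) (x Y₁ : ℝ) (h : ℤ) (L : ℝ) (m : ℤ) (u t : ℝ) : ℂ :=
  if colA R u t = 0 then 0 else
    ((tothPlateau x Y₁ (colA R u t / a) : ℝ) : ℂ) * ex (h * colPhi R b u t) *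
      ((colPsi R L m u t : ℝ) : ℂ)

/-- `‖colFn‖ ≤ 1`. [folklore] -/
theorem norm_colFn_le_one (R : BinQF) (a b : ℤ) (x Y₁ : ℝ) (h : ℤ) (L : ℝ) (m : ℤ) (u t : ℝ) :
    ‖colFn R a b x Y₁ h L m u t‖ ≤ 1 := by
  unfold colFn
  split_ifs
  · simp
  · rw [norm_mul, norm_mul, Complex.norm_real, Complex.norm_real, norm_ex, mul_one,
      Real.norm_eq_abs, Real.norm_eq_abs, abs_of_nonneg (tothPlateau_nonneg _ _ _),
      abs_of_nonneg (colPsi_nonneg _ _ _ _ _)]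
    exact mul_le_one₀ (tothPlateau_le_one _ _ _) (colPsi_nonneg _ _ _ _ _) (colPsi_le_one _ _ _ _ _)

/-! ### Support -/

/-- `G_{x,Y₁}(s) ≠ 0 ⇒ x − x/Y₁ < s < 2x + x/Y₁`. [folklore] -/
theorem tothPlateau_support {x Y₁ s : ℝ} (hx : 0 < x) (hY : 0 < Y₁) (h : tothPlateau x Y₁ s ≠ 0) :
    x - x / Y₁ < s ∧ s < 2 * x + x / Y₁ := by
  constructor
  · by_contra h'; exact h (tothPlateau_eq_zero_of_le hx hY (not_lt.1 h'))
  · by_contra h'; exact h (tothPlateau_eq_zero_of_ge hx hY (not_lt.1 h'))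

/-- For `Y₁ ≥ 2`: `G_{x,Y₁}(s) ≠ 0 ⇒ x/2 < s < 5x/2`. [folklore] -/
theorem tothPlateau_support' {x Y₁ s : ℝ} (hx : 0 < x) (hY : 2 ≤ Y₁) (h : tothPlateau x Y₁ s ≠ 0) :
    x / 2 < s ∧ s < 5 / 2 * x := by
  have hY0 : 0 < Y₁ := by linarith
  obtain ⟨h1, h2⟩ := tothPlateau_support hx hY0 h
  have hxY : x / Y₁ ≤ x / 2 := div_le_div_of_nonneg_left hx.le (by norm_num) hY
  constructor <;> linarith

/-- `ψ ≠ 0` and `κ ≠ 0 ⇒ e^{mL} < |κ| < e^{(m+2)L}`. [cite: Ngo2024, §3.4 Lemma 3.11 (3)] -/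
theorem colPsi_support {L : ℝ} (hL : 0 < L) {m : ℤ} {u t : ℝ} (hK : colK R u t ≠ 0)
    (h : colPsi R L m u t ≠ 0) :
    Real.exp (m * L) < |colK R u t| ∧ |colK R u t| < Real.exp ((m + 2) * L) := by
  obtain ⟨h0, h2⟩ := pos_lt_two_of_unitPartition_ne_zero h
  have hpos : 0 < |colK R u t| := abs_pos.2 hK
  constructor
  · rw [← Real.exp_log hpos]
    apply Real.exp_lt_exp.2
    have : (m : ℝ) < Real.log |colK R u t| / L := by linarith
    rwa [lt_div_iff₀ hL] at this
  · rw [← Real.exp_log hpos]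
    apply Real.exp_lt_exp.2
    have : Real.log |colK R u t| / L < m + 2 := by linarith
    rwa [div_lt_iff₀ hL] at this

/-- What `colFn ≠ 0` forces. [cite: Ngo2024, §3.4 Lemma 3.11 (3), §3.5] -/
theorem colFn_support (hA : R.a ≠ 0) (hΔ : 0 < R.disc) {a : ℤ} (ha : 0 < a) {b : ℤ} {x Y₁ : ℝ}
    (hx : 0 < x) (hY : 2 ≤ Y₁) {h : ℤ} {L : ℝ} (hL : 0 < L) {m : ℤ} {u t : ℝ}
    (hF : colFn R a b x Y₁ h L m u t ≠ 0) :
    (u - t * rootPlus R ≠ 0 ∧ u - t * rootMinus R ≠ 0) ∧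
      ((a : ℝ) * x / 2 < colA R u t ∧ colA R u t < 5 / 2 * a * x) ∧
      (Real.exp (m * L) < |colK R u t| ∧ |colK R u t| < Real.exp ((m + 2) * L)) := by
  unfold colFn at hF
  split_ifs at hF with h0
  · exact absurd rfl hF
  have hP : u - t * rootPlus R ≠ 0 := by
    intro hP; apply h0; rw [colA_eq_mul hA hΔ.le, hP, zero_mul, mul_zero]
  have hM : u - t * rootMinus R ≠ 0 := by
    intro hM; apply h0; rw [colA_eq_mul hA hΔ.le, hM, mul_zero, mul_zero]
  have hG : tothPlateau x Y₁ (colA R u t / a) ≠ 0 := by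
    intro hG; apply hF; rw [hG]; simp
  have hψ : colPsi R L m u t ≠ 0 := by
    intro hψ; apply hF; rw [hψ]; simp
  have ha0 : (0 : ℝ) < a := by exact_mod_cast ha
  obtain ⟨h1, h2⟩ := tothPlateau_support' hx hY hG
  refine ⟨⟨hP, hM⟩, ⟨?_, ?_⟩, colPsi_support hL (div_ne_zero hP hM) hψ⟩
  · rw [lt_div_iff₀ ha0] at h1; linarith
  · rw [div_lt_iff₀ ha0] at h2; linarith

/-- From `lo·x ≤ y² ≤ hi·x` to `√lo √x ≤ |y| ≤ √hi √x`. [folklore] -/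
theorem abs_bounds_of_sq_bounds {lo hi x y : ℝ} (hlo : 0 ≤ lo) (hx : 0 ≤ x)
    (h1 : lo * x ≤ y ^ 2) (h2 : y ^ 2 ≤ hi * x) :
    Real.sqrt lo * Real.sqrt x ≤ |y| ∧ |y| ≤ Real.sqrt hi * Real.sqrt x := by
  constructor
  · rw [← Real.sqrt_mul hlo, ← Real.sqrt_sq_eq_abs]
    exact Real.sqrt_le_sqrt h1
  · rw [← Real.sqrt_sq_eq_abs, ← Real.sqrt_mul' _ hx]
    exact Real.sqrt_le_sqrt h2

/-- **Support geometry of the column function** (Ngo: "`c ≍ d ≍ √x`"): there are constants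
`0 < c₁ ≤ c₂` depending only on `R, a, L, m` such that wherever `colFn ≠ 0` (with `x > 0`,
`Y₁ ≥ 2`): `c₁√x ≤ |u − tθ₊|, |u − tθ₋| ≤ c₂√x`, `|t| ≤ c₂√x`, `|u| ≤ c₂√x`.
[cite: Ngo2024, §3.4 Lemma 3.11 (3), §3.5 proof of Lemma 3.16] -/
theorem exists_colFn_support_consts (hA : R.a ≠ 0) (hΔ : 0 < R.disc) {a : ℤ} (ha : 0 < a)
    {L : ℝ} (hL : 0 < L) (m : ℤ) :
    ∃ c₁ c₂ : ℝ, 0 < c₁ ∧ c₁ ≤ c₂ ∧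
      ∀ (b : ℤ) (x Y₁ : ℝ) (h : ℤ) (u t : ℝ), 0 < x → 2 ≤ Y₁ →
        colFn R a b x Y₁ h L m u t ≠ 0 →
          (c₁ * Real.sqrt x ≤ |u - t * rootPlus R| ∧ |u - t * rootPlus R| ≤ c₂ * Real.sqrt x) ∧
          (c₁ * Real.sqrt x ≤ |u - t * rootMinus R| ∧ |u - t * rootMinus R| ≤ c₂ * Real.sqrt x) ∧
          |t| ≤ c₂ * Real.sqrt x ∧ |u| ≤ c₂ * Real.sqrt x := by
  -- the constants
  obtain ⟨A₀, hA₀⟩ : ∃ A₀ : ℝ, A₀ = |(R.a : ℝ)| := ⟨_, rfl⟩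
  have hA₀0 : 0 < A₀ := by rw [hA₀]; exact abs_pos.2 (by exact_mod_cast hA)
  obtain ⟨κlo, hκlo⟩ : ∃ κlo : ℝ, κlo = Real.exp (m * L) := ⟨_, rfl⟩
  obtain ⟨κhi, hκhi⟩ : ∃ κhi : ℝ, κhi = Real.exp ((m + 2) * L) := ⟨_, rfl⟩
  have hκlo0 : 0 < κlo := by rw [hκlo]; exact Real.exp_pos _
  have hκhi0 : 0 < κhi := by rw [hκhi]; exact Real.exp_pos _
  have ha0 : (0 : ℝ) < a := by exact_mod_cast ha
  obtain ⟨lo, hlo⟩ : ∃ lo : ℝ, lo = min (a * κlo / (2 * A₀)) (a / (2 * A₀ * κhi)) := ⟨_, rfl⟩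
  obtain ⟨hi, hhi⟩ : ∃ hi : ℝ, hi = max (5 * a * κhi / (2 * A₀)) (5 * a / (2 * A₀ * κlo)) := ⟨_, rfl⟩
  have hlo0 : 0 < lo := by rw [hlo]; exact lt_min (by positivity) (by positivity)
  have hhi0 : 0 < hi := by rw [hhi]; exact lt_max_of_lt_left (by positivity)
  have hlohi : lo ≤ hi := by
    rw [hlo, hhi]
    calc min (a * κlo / (2 * A₀)) (a / (2 * A₀ * κhi)) ≤ a * κlo / (2 * A₀) := min_le_left _ _
      _ ≤ 5 * a * κhi / (2 * A₀) := by
          rw [div_le_div_iff_of_pos_right (by positivity)]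
          have : κlo ≤ κhi := by rw [hκlo, hκhi]; exact Real.exp_le_exp.2 (by nlinarith)
          nlinarith
      _ ≤ _ := le_max_left _ _
  obtain ⟨θm, hθm⟩ : ∃ θm : ℝ, θm = |rootPlus R| + 1 := ⟨_, rfl⟩
  have hθm0 : 0 < θm := by rw [hθm]; positivity
  obtain ⟨δ, hδ⟩ : ∃ δ : ℝ, δ = |rootPlus R - rootMinus R| := ⟨_, rfl⟩
  have hδ0 : 0 < δ := by rw [hδ]; exact abs_pos.2 (sub_ne_zero.2 (rootPlus_ne_rootMinus hA hΔ))
  refine ⟨Real.sqrt lo, Real.sqrt hi * (1 + 2 / δ + 2 * θm / δ), Real.sqrt_pos.2 hlo0, ?_, ?_⟩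
  · calc Real.sqrt lo ≤ Real.sqrt hi := Real.sqrt_le_sqrt hlohi
      _ = Real.sqrt hi * 1 := (mul_one _).symm
      _ ≤ Real.sqrt hi * (1 + 2 / δ + 2 * θm / δ) := by
          apply mul_le_mul_of_nonneg_left _ (Real.sqrt_nonneg _)
          have : 0 ≤ 2 / δ := by positivity
          have : 0 ≤ 2 * θm / δ := by positivity
          linarith
  intro b x Y₁ h u t hx hY hF
  obtain ⟨⟨hP, hM⟩, ⟨hA1, hA2⟩, ⟨hK1, hK2⟩⟩ := colFn_support hA hΔ ha hx hY hL hF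
  rw [← hκlo] at hK1
  rw [← hκhi] at hK2
  -- `|P| |M|` and `|P|/|M|`
  set P := u - t * rootPlus R with hPdef
  set M := u - t * rootMinus R with hMdef
  have hPM : |P| * |M| = |colA R u t| / A₀ := by
    rw [colA_eq_mul hA hΔ.le, abs_mul, abs_mul, ← hA₀]
    field_simp
    rfl
  have hcolA_pos : 0 < colA R u t := by
    have : (0 : ℝ) < a * x / 2 := by positivity
    linarith
  have hPM1 : a * x / (2 * A₀) ≤ |P| * |M| := by
    rw [hPM, abs_of_pos hcolA_pos]
    rw [div_le_div_iff₀ (by positivity) hA₀0]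
    nlinarith
  have hPM2 : |P| * |M| ≤ 5 * a * x / (2 * A₀) := by
    rw [hPM, abs_of_pos hcolA_pos, div_le_div_iff₀ hA₀0 (by positivity)]
    nlinarith
  have hMpos : 0 < |M| := abs_pos.2 hM
  have hPpos : 0 < |P| := abs_pos.2 hP
  have hKdef : |colK R u t| = |P| / |M| := by rw [colK, abs_div]
  rw [hKdef] at hK1 hK2
  -- `|P|² ∈ [lo x, hi x]`, `|M|² ∈ [lo x, hi x]`
  have hP2lo : lo * x ≤ P ^ 2 := by
    have e : P ^ 2 = (|P| * |M|) * (|P| / |M|) := by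
      rw [← sq_abs]; field_simp
    rw [e]
    calc lo * x ≤ (a * κlo / (2 * A₀)) * x := by
          apply mul_le_mul_of_nonneg_right _ hx.le; rw [hlo]; exact min_le_left _ _
      _ = (a * x / (2 * A₀)) * κlo := by ring
      _ ≤ (|P| * |M|) * (|P| / |M|) :=
          mul_le_mul hPM1 hK1.le hκlo0.le (by positivity)
  have hP2hi : P ^ 2 ≤ hi * x := by
    have e : P ^ 2 = (|P| * |M|) * (|P| / |M|) := by
      rw [← sq_abs]; field_simp
    rw [e]
    calc (|P| * |M|) * (|P| / |M|) ≤ (5 * a * x / (2 * A₀)) * κhi :=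
          mul_le_mul hPM2 hK2.le (by positivity) (by positivity)
      _ = (5 * a * κhi / (2 * A₀)) * x := by ring
      _ ≤ hi * x := by
          apply mul_le_mul_of_nonneg_right _ hx.le; rw [hhi]; exact le_max_left _ _
  have hM2lo : lo * x ≤ M ^ 2 := by
    have e : M ^ 2 = (|P| * |M|) / (|P| / |M|) := by
      rw [← sq_abs M]; field_simp
    rw [e, le_div_iff₀ (by positivity)]
    calc lo * x * (|P| / |M|) ≤ (a / (2 * A₀ * κhi)) * x * κhi := by
          apply mul_le_mul _ hK2.le (by positivity) (by positivity)
          apply mul_le_mul_of_nonneg_right _ hx.le; rw [hlo]; exact min_le_right _ _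
      _ = a * x / (2 * A₀) := by field_simp
      _ ≤ |P| * |M| := hPM1
  have hM2hi : M ^ 2 ≤ hi * x := by
    have e : M ^ 2 = (|P| * |M|) / (|P| / |M|) := by
      rw [← sq_abs M]; field_simp
    rw [e, div_le_iff₀ (by positivity)]
    calc |P| * |M| ≤ 5 * a * x / (2 * A₀) := hPM2
      _ = (5 * a / (2 * A₀ * κlo)) * x * κlo := by field_simp
      _ ≤ hi * x * (|P| / |M|) := by
          apply mul_le_mul _ hK1.le hκlo0.le (by positivity)
          apply mul_le_mul_of_nonneg_right _ hx.le; rw [hhi]; exact le_max_right _ _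
  obtain ⟨hPlo, hPhi⟩ := abs_bounds_of_sq_bounds hlo0.le hx.le hP2lo hP2hi
  obtain ⟨hMlo, hMhi⟩ := abs_bounds_of_sq_bounds hlo0.le hx.le hM2lo hM2hi
  -- `t` and `u`
  set S := Real.sqrt hi * Real.sqrt x with hSdef
  have hS0 : 0 ≤ S := by positivity
  have ht : |t| ≤ 2 / δ * S := by
    have e : t * (rootPlus R - rootMinus R) = M - P := by rw [hPdef, hMdef]; ring
    have h1 : |t| * δ = |M - P| := by rw [hδ, ← abs_mul, e]
    have h2 : |M - P| ≤ 2 * S := (abs_sub _ _).trans (by linarith)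
    rw [div_mul_eq_mul_div, le_div_iff₀ hδ0]
    linarith
  have hu : |u| ≤ (1 + 2 * θm / δ) * S := by
    have e : u = P + t * rootPlus R := by rw [hPdef]; ring
    have h1 : |u| ≤ |P| + |t| * |rootPlus R| := by
      rw [e]; exact (abs_add_le _ _).trans (by rw [abs_mul])
    have h2 : |t| * |rootPlus R| ≤ (2 / δ * S) * θm := by
      apply mul_le_mul ht _ (abs_nonneg _) (by positivity)
      rw [hθm]; linarith
    calc |u| ≤ S + (2 / δ * S) * θm := h1.trans (add_le_add hPhi h2)
      _ = (1 + 2 * θm / δ) * S := by ring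
  have hδ2 : 0 ≤ 2 / δ := by positivity
  have hθδ : 0 ≤ 2 * θm / δ := by positivity
  refine ⟨⟨hPlo, ?_⟩, ⟨hMlo, ?_⟩, ?_, ?_⟩
  · calc |P| ≤ S := hPhi
      _ = S * 1 := (mul_one _).symm
      _ ≤ S * (1 + 2 / δ + 2 * θm / δ) := mul_le_mul_of_nonneg_left (by linarith) hS0
      _ = _ := by rw [hSdef]; ring
  · calc |M| ≤ S := hMhi
      _ = S * 1 := (mul_one _).symm
      _ ≤ S * (1 + 2 / δ + 2 * θm / δ) := mul_le_mul_of_nonneg_left (by linarith) hS0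
      _ = _ := by rw [hSdef]; ring
  · calc |t| ≤ 2 / δ * S := ht
      _ = S * (2 / δ) := mul_comm _ _
      _ ≤ S * (1 + 2 / δ + 2 * θm / δ) := mul_le_mul_of_nonneg_left (by linarith) hS0
      _ = _ := by rw [hSdef]; ring
  · calc |u| ≤ (1 + 2 * θm / δ) * S := hu
      _ = S * (1 + 2 * θm / δ) := mul_comm _ _
      _ ≤ S * (1 + 2 / δ + 2 * θm / δ) := mul_le_mul_of_nonneg_left (by linarith) hS0
      _ = _ := by rw [hSdef]; ring

/-! ### Smoothness -/

/-- The plateau is smooth. [folklore] -/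
theorem contDiff_tothPlateau (x Y₁ : ℝ) {n : ℕ∞} : ContDiff ℝ n (tothPlateau x Y₁) := by
  have h : tothPlateau x Y₁ = fun t => Real.smoothTransition ((t - (x - x / Y₁)) * (Y₁ / x)) *
      Real.smoothTransition ((2 * x + x / Y₁ - t) * (Y₁ / x)) := rfl
  rw [h]
  exact (Real.smoothTransition.contDiff.comp (by fun_prop)).mul
    (Real.smoothTransition.contDiff.comp (by fun_prop))

/-- `e(·) : ℝ → ℂ` is smooth. [folklore] -/
theorem contDiff_ex {n : ℕ∞} : ContDiff ℝ n ex := by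
  have h : ex = fun s : ℝ => Complex.exp (2 * Real.pi * Complex.I * s) := rfl
  rw [h]
  exact (Complex.contDiff_exp (𝕜 := ℝ)).comp (contDiff_const.mul Complex.ofRealCLM.contDiff)

/-- `colPhi` is smooth at points where `u ≠ 0` and `colA ≠ 0`. [folklore] -/
theorem contDiffAt_colPhi (R : BinQF) (b : ℤ) {u : ℝ} (hu : u ≠ 0) {t : ℝ} (ht : colA R u t ≠ 0)
    {n : ℕ∞} : ContDiffAt ℝ n (fun s => colPhi R b u s) t := by
  unfold colPhi
  have hA : ContDiffAt ℝ n (fun s => colA R u s) t := (contDiff_colA R u).contDiffAt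
  apply ContDiffAt.sub
  · apply ContDiffAt.div (by fun_prop) (contDiffAt_const.mul hA)
    exact mul_ne_zero (mul_ne_zero two_ne_zero hu) ht
  · apply ContDiffAt.div (by fun_prop) (contDiffAt_const.mul hA)
    exact mul_ne_zero two_ne_zero ht

/-- `colK` is smooth at points where `u − tθ₋ ≠ 0`. [folklore] -/
theorem contDiffAt_colK (R : BinQF) {u t : ℝ} (hM : u - t * rootMinus R ≠ 0) {n : ℕ∞} :
    ContDiffAt ℝ n (fun s => colK R u s) t := by
  unfold colK
  exact ContDiffAt.div (by fun_prop) (by fun_prop) hM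

/-- `colPsi` is smooth at points where both root factors are nonzero. [folklore] -/
theorem contDiffAt_colPsi (R : BinQF) (L : ℝ) (m : ℤ) {u t : ℝ} (hP : u - t * rootPlus R ≠ 0)
    (hM : u - t * rootMinus R ≠ 0) {n : ℕ∞} : ContDiffAt ℝ n (fun s => colPsi R L m u s) t := by
  have hK : colK R u t ≠ 0 := div_ne_zero hP hM
  have h : (fun s => colPsi R L m u s) =
      fun s => unitPartition (Real.log (colK R u s) / L - m) := by
    funext s; rw [colPsi, Real.log_abs]
  rw [h]
  apply contDiff_unitPartition.contDiffAt.comp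
  apply ContDiffAt.sub _ contDiffAt_const
  apply ContDiffAt.div_const
  exact (Real.contDiffAt_log.2 hK).comp t (contDiffAt_colK R hM)

/-- Near a zero of `colA(u, ·)` the column function vanishes identically (`x ≥ 1`, `Y₁ ≥ 2`,
`a ≥ 1`: the plateau needs `colA/a > x/2`). [folklore] -/
theorem colFn_eventuallyEq_zero (hA : R.a ≠ 0) (hΔ : 0 < R.disc) {a : ℤ} (ha : 0 < a) (b : ℤ)
    {x Y₁ : ℝ} (hx : 0 < x) (hY : 2 ≤ Y₁) (h : ℤ) {L : ℝ} (hL : 0 < L) (m : ℤ) (u : ℝ) {t₀ : ℝ}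
    (h0 : colA R u t₀ = 0) :
    (fun t => colFn R a b x Y₁ h L m u t) =ᶠ[nhds t₀] fun _ => 0 := by
  have ha0 : (0 : ℝ) < a := by exact_mod_cast ha
  have hev : ∀ᶠ t in nhds t₀, colA R u t < a * x / 2 := by
    apply (continuous_colA R u).continuousAt.eventually_lt continuousAt_const
    rw [h0]; positivity
  filter_upwards [hev] with t ht
  by_contra hF
  obtain ⟨-, ⟨h1, -⟩, -⟩ := colFn_support hA hΔ ha hx hY hL hF
  linarith

/-- **The column function is smooth in `t`** (`u ≠ 0`). [cite: Ngo2024, §3.5 Lemma 3.15 (the smooth compactly supported `F`)] -/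
theorem contDiff_colFn (hA : R.a ≠ 0) (hΔ : 0 < R.disc) {a : ℤ} (ha : 0 < a) (b : ℤ) {x Y₁ : ℝ}
    (hx : 0 < x) (hY : 2 ≤ Y₁) (h : ℤ) {L : ℝ} (hL : 0 < L) (m : ℤ) {u : ℝ} (hu : u ≠ 0)
    {n : ℕ∞} : ContDiff ℝ n (fun t => colFn R a b x Y₁ h L m u t) := by
  refine contDiff_iff_contDiffAt.2 fun t₀ => ?_
  by_cases h0 : colA R u t₀ = 0
  · exact (contDiffAt_const (c := (0 : ℂ))).congr_of_eventuallyEq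
      (colFn_eventuallyEq_zero hA hΔ ha b hx hY h hL m u h0)
  · have hP : u - t₀ * rootPlus R ≠ 0 := by
      intro hP; apply h0; rw [colA_eq_mul hA hΔ.le, hP, zero_mul, mul_zero]
    have hM : u - t₀ * rootMinus R ≠ 0 := by
      intro hM; apply h0; rw [colA_eq_mul hA hΔ.le, hM, mul_zero, mul_zero]
    have hev : ∀ᶠ t in nhds t₀, colA R u t ≠ 0 :=
      (continuous_colA R u).continuousAt.eventually_ne h0
    have hprod : ContDiffAt ℝ n (fun t =>
        ((tothPlateau x Y₁ (colA R u t / a) : ℝ) : ℂ) * ex (h * colPhi R b u t) *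
          ((colPsi R L m u t : ℝ) : ℂ)) t₀ := by
      apply ContDiffAt.mul
      · apply ContDiffAt.mul
        · exact (Complex.ofRealCLM.contDiff.comp
            ((contDiff_tothPlateau x Y₁).comp ((contDiff_colA R u).div_const _))).contDiffAt
        · exact contDiff_ex.contDiffAt.comp t₀
            (contDiffAt_const.mul (contDiffAt_colPhi R b hu h0))
      · exact Complex.ofRealCLM.contDiff.contDiffAt.comp t₀ (contDiffAt_colPsi R L m hP hM)
    refine hprod.congr_of_eventuallyEq ?_
    filter_upwards [hev] with t ht
    rw [colFn, if_neg ht]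

/-- The column function has compact support in `t` (`u ≠ 0`... in fact for all `u`): it vanishes
for `|t| > c₂√x`. [cite: Ngo2024, §3.5 Lemma 3.15] -/
theorem hasCompactSupport_colFn (hA : R.a ≠ 0) (hΔ : 0 < R.disc) {a : ℤ} (ha : 0 < a) (b : ℤ)
    {x Y₁ : ℝ} (hx : 0 < x) (hY : 2 ≤ Y₁) (h : ℤ) {L : ℝ} (hL : 0 < L) (m : ℤ) (u : ℝ) :
    HasCompactSupport (fun t => colFn R a b x Y₁ h L m u t) := by
  obtain ⟨c₁, c₂, -, -, hc⟩ := exists_colFn_support_consts hA hΔ ha hL m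
  apply HasCompactSupport.of_support_subset_isCompact (isCompact_Icc (a := -(c₂ * Real.sqrt x))
    (b := c₂ * Real.sqrt x))
  intro t ht
  rw [Function.mem_support] at ht
  obtain ⟨-, -, htb, -⟩ := hc b x Y₁ h u t hx hY ht
  exact Set.mem_Icc.2 (abs_le.1 htb)

end RootForms

end Literature.NumberTheory.Sieve

/-!
## Part 2. Derivative bounds for the column function of the Tóth sums, I: tools

Topic `Literature/NumberTheory/Sieve`.  Generic one-variable tools for the derivative bounds of
`colFn` (Part 1) (T. Ngo, arXiv:2107.13301, §3.5 Lemmas 3.16–3.17, §3.6 Lemma 3.20: "the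
derivatives of the weight are `≪ (Y₁/√x)^j`"):

* `iteratedDeriv_ex`, `norm_iteratedDeriv_ex` — `∂ʲ e(s) = (2πi)ʲ e(s)`;
* `norm_iteratedDeriv_comp_le_of_isOpen` — Faà di Bruno bound (Mathlib's
  `norm_iteratedFDerivWithin_comp_le`) for `g ∘ f` with `g` globally smooth with bounded
  derivatives and `f` smooth on an OPEN set only (our inner maps have poles off the support);
* `norm_iteratedDeriv_ex_comp_le`, `norm_iteratedDeriv_unitPartitionC_comp_le` — the two outer
  functions we need (`e(·)` and Tóth's `β`, complexified);
* `iteratedDeriv_inv_linear`, `norm_iteratedDeriv_inv_linear_le` — `∂ᵏ (ct + d)⁻¹`;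
* `iteratedDeriv_succ_log_abs_linear`, `norm_iteratedDeriv_log_abs_linear_le` — `∂ᵏ⁺¹ log|ct + d|`
  away from the pole.

## References

* T. Ngo, *On roots of quadratic congruences*, arXiv:2107.13301, §3.5 Lemmas 3.16–3.17, §3.6
  Lemma 3.20. [cite: Ngo2024, §3.5 Lemma 3.17, §3.6 Lemma 3.20]
* Á. Tóth, *Roots of quadratic congruences*, IMRN 2000, 719–739. [cite: Toth2000, §4]
-/

noncomputable section

namespace Literature.NumberTheory.Sieve

namespace RootForms

open Real Set
open Literature.NumberTheory.QuadraticFields.Quadratic (BinQF)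
open Literature.NumberTheory.Sieve.FriedlanderIwaniecPrimes (smoothTransitionC
  exists_bound_iteratedFDeriv_smoothTransition norm_iteratedFDeriv_smoothTransitionC_le
  contDiff_smoothTransitionC)

/-! ### Derivatives of `e(s) = exp(2πis)` -/

/-- `e'(s) = 2πi e(s)`. [folklore] -/
theorem hasDerivAt_ex (s : ℝ) : HasDerivAt ex (2 * Real.pi * Complex.I * ex s) s := by
  have h1 : HasDerivAt (fun r : ℝ => 2 * Real.pi * Complex.I * (r : ℂ)) (2 * Real.pi * Complex.I) s := by
    have h0 : HasDerivAt (fun r : ℝ => ((r : ℝ) : ℂ)) 1 s := by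
      simpa using (hasDerivAt_id s).ofReal_comp
    simpa using h0.const_mul (2 * Real.pi * Complex.I)
  have h2 : HasDerivAt (fun r : ℝ => Complex.exp (2 * Real.pi * Complex.I * (r : ℂ)))
      (Complex.exp (2 * Real.pi * Complex.I * (s : ℂ)) * (2 * Real.pi * Complex.I)) s :=
    (Complex.hasDerivAt_exp _).comp s h1
  have h3 : HasDerivAt ex (Complex.exp (2 * Real.pi * Complex.I * (s : ℂ)) * (2 * Real.pi * Complex.I)) s :=
    h2
  refine h3.congr_deriv ?_
  rw [ex]
  ring

/-- `deriv e = 2πi e`. [folklore] -/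
theorem deriv_ex : deriv ex = fun s => 2 * Real.pi * Complex.I * ex s :=
  funext fun s => (hasDerivAt_ex s).deriv

/-- **`∂ʲ e(s) = (2πi)ʲ e(s)`.** [folklore] -/
theorem iteratedDeriv_ex (j : ℕ) : iteratedDeriv j ex = fun s => (2 * Real.pi * Complex.I) ^ j * ex s := by
  induction j with
  | zero => funext s; simp
  | succ j ih =>
      rw [iteratedDeriv_succ', deriv_ex]
      funext s
      rw [iteratedDeriv_const_mul_field, ih]
      ring

/-- `‖∂ʲ e(s)‖ = (2π)ʲ`. [folklore] -/
theorem norm_iteratedDeriv_ex (j : ℕ) (s : ℝ) : ‖iteratedDeriv j ex s‖ = (2 * Real.pi) ^ j := by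
  rw [iteratedDeriv_ex]
  simp only [norm_mul, norm_pow, norm_ex, mul_one, Complex.norm_I, Complex.norm_real,
    Real.norm_eq_abs, abs_of_pos Real.pi_pos, Complex.norm_ofNat]

/-- `‖∂ⁱ e‖ ≤ (2π)ⁿ` for `i ≤ n`. [folklore] -/
theorem norm_iteratedDeriv_ex_le {i n : ℕ} (hi : i ≤ n) (s : ℝ) :
    ‖iteratedDeriv i ex s‖ ≤ (2 * Real.pi) ^ n := by
  rw [norm_iteratedDeriv_ex]
  exact pow_le_pow_right₀ (by linarith [Real.pi_gt_three]) hi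

/-! ### Faà di Bruno bound with an inner map smooth on an open set -/

/-- **Composition bound on an open set.**  If `g` is smooth with `‖g⁽ⁱ⁾‖ ≤ C` (`i ≤ n`) and `f` is
smooth on an open `U ∋ t` with `‖f⁽ⁱ⁾(t)‖ ≤ Dⁱ` (`1 ≤ i ≤ n`), then
`‖(g ∘ f)⁽ⁿ⁾(t)‖ ≤ n! C Dⁿ` (Mathlib's `norm_iteratedFDerivWithin_comp_le`). [folklore] -/
theorem norm_iteratedDeriv_comp_le_of_isOpen {G : Type*} [NormedAddCommGroup G] [NormedSpace ℝ G]
    {g : ℝ → G} {f : ℝ → ℝ} {U : Set ℝ} (hU : IsOpen U) (hg : ContDiff ℝ (⊤ : ℕ∞) g)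
    (hf : ContDiffOn ℝ (⊤ : ℕ∞) f U) {t : ℝ} (ht : t ∈ U) {n : ℕ} {C D : ℝ}
    (hC : ∀ i ≤ n, ∀ s : ℝ, ‖iteratedDeriv i g s‖ ≤ C)
    (hD : ∀ i, 1 ≤ i → i ≤ n → ‖iteratedDeriv i f t‖ ≤ D ^ i) :
    ‖iteratedDeriv n (fun s => g (f s)) t‖ ≤ n.factorial * C * D ^ n := by
  have hUd : UniqueDiffOn ℝ U := hU.uniqueDiffOn
  have h := norm_iteratedFDerivWithin_comp_le (g := g) (f := f) (s := U) (t := Set.univ) (x := t)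
    (n := n) (N := ((⊤ : ℕ∞) : WithTop ℕ∞)) hg.contDiffOn hf (by exact_mod_cast le_top) uniqueDiffOn_univ
    hUd (Set.mapsTo_univ _ _) ht (C := C) (D := D) ?_ ?_
  · rw [(iteratedFDerivWithin_of_isOpen n hU) ht, norm_iteratedFDeriv_eq_norm_iteratedDeriv] at h
    exact h
  · intro i hi
    rw [iteratedFDerivWithin_univ, norm_iteratedFDeriv_eq_norm_iteratedDeriv]
    exact hC i hi _
  · intro i hi1 hin
    rw [(iteratedFDerivWithin_of_isOpen i hU) ht, norm_iteratedFDeriv_eq_norm_iteratedDeriv]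
    exact hD i hi1 hin

/-- **The phase factor**: `‖∂ⁿ e(f(t))‖ ≤ n! (2π)ⁿ Dⁿ` under the same hypotheses on `f`.
[cite: Ngo2024, §3.5 Lemma 3.17] -/
theorem norm_iteratedDeriv_ex_comp_le {f : ℝ → ℝ} {U : Set ℝ} (hU : IsOpen U)
    (hf : ContDiffOn ℝ (⊤ : ℕ∞) f U) {t : ℝ} (ht : t ∈ U) {n : ℕ} {D : ℝ}
    (hD : ∀ i, 1 ≤ i → i ≤ n → ‖iteratedDeriv i f t‖ ≤ D ^ i) :
    ‖iteratedDeriv n (fun s => ex (f s)) t‖ ≤ n.factorial * (2 * Real.pi) ^ n * D ^ n :=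
  norm_iteratedDeriv_comp_le_of_isOpen hU contDiff_ex hf ht (fun _ hi s => norm_iteratedDeriv_ex_le hi s) hD

/-! ### Tóth's `β`, complexified -/

/-- `β_ℂ = ofReal ∘ β`. [folklore] -/
def unitPartitionC (s : ℝ) : ℂ := ((unitPartition s : ℝ) : ℂ)

/-- `β_ℂ(s) = Z_ℂ(s) − Z_ℂ(s − 1)`. [folklore] -/
theorem unitPartitionC_eq : unitPartitionC = fun s => smoothTransitionC s - smoothTransitionC (s - 1) := by
  funext s
  simp [unitPartitionC, unitPartition, smoothTransitionC]

/-- `β_ℂ` is smooth. [folklore] -/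
theorem contDiff_unitPartitionC {n : ℕ∞} : ContDiff ℝ n unitPartitionC :=
  Complex.ofRealCLM.contDiff.comp contDiff_unitPartition

/-- **Bounded derivatives of `β_ℂ`**: `‖β_ℂ⁽ⁱ⁾‖ ≤ 2M` whenever `‖Z⁽ⁱ⁾‖ ≤ M` (`i ≤ n`). [folklore] -/
theorem norm_iteratedDeriv_unitPartitionC_le {n : ℕ} {M : ℝ}
    (hM : ∀ i ≤ n, ∀ s : ℝ, ‖iteratedFDeriv ℝ i Real.smoothTransition s‖ ≤ M) :
    ∀ i ≤ n, ∀ s : ℝ, ‖iteratedDeriv i unitPartitionC s‖ ≤ 2 * M := by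
  intro i hi s
  have hZ := norm_iteratedFDeriv_smoothTransitionC_le hM
  have h1 : ‖iteratedDeriv i smoothTransitionC s‖ ≤ M := by
    rw [← norm_iteratedFDeriv_eq_norm_iteratedDeriv]; exact hZ i hi s
  have h2 : ‖iteratedDeriv i (fun r => smoothTransitionC (r - 1)) s‖ ≤ M := by
    rw [iteratedDeriv_comp_sub_const, ← norm_iteratedFDeriv_eq_norm_iteratedDeriv]; exact hZ i hi _
  have hc1 : ContDiffAt ℝ i smoothTransitionC s :=
    (contDiff_smoothTransitionC.of_le (by exact_mod_cast le_top)).contDiffAt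
  have hc2 : ContDiffAt ℝ i (fun r => smoothTransitionC (r - 1)) s :=
    ((contDiff_smoothTransitionC.of_le (by exact_mod_cast le_top)).comp
      (contDiff_id.sub contDiff_const)).contDiffAt
  have hfun : unitPartitionC = smoothTransitionC - fun r => smoothTransitionC (r - 1) := by
    rw [unitPartitionC_eq]; rfl
  rw [hfun, iteratedDeriv_sub hc1 hc2]
  exact (norm_sub_le _ _).trans (by linarith)

/-- A bound `Mₙ ≥ 1` for the derivatives of `β_ℂ` of order `≤ n`. [folklore] -/
theorem exists_bound_iteratedDeriv_unitPartitionC (n : ℕ) :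
    ∃ M : ℝ, 1 ≤ M ∧ ∀ i ≤ n, ∀ s : ℝ, ‖iteratedDeriv i unitPartitionC s‖ ≤ M := by
  obtain ⟨M, hM1, hM⟩ := exists_bound_iteratedFDeriv_smoothTransition n
  exact ⟨2 * M, by linarith, norm_iteratedDeriv_unitPartitionC_le hM⟩

/-- **The `ψ` factor**: `‖∂ⁿ β_ℂ(f(t))‖ ≤ n! M Dⁿ`. [cite: Ngo2024, §3.4 Lemma 3.11, §3.5 Lemma 3.17] -/
theorem norm_iteratedDeriv_unitPartitionC_comp_le {f : ℝ → ℝ} {U : Set ℝ} (hU : IsOpen U)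
    (hf : ContDiffOn ℝ (⊤ : ℕ∞) f U) {t : ℝ} (ht : t ∈ U) {n : ℕ} {M D : ℝ}
    (hM : ∀ i ≤ n, ∀ s : ℝ, ‖iteratedDeriv i unitPartitionC s‖ ≤ M)
    (hD : ∀ i, 1 ≤ i → i ≤ n → ‖iteratedDeriv i f t‖ ≤ D ^ i) :
    ‖iteratedDeriv n (fun s => unitPartitionC (f s)) t‖ ≤ n.factorial * M * D ^ n :=
  norm_iteratedDeriv_comp_le_of_isOpen hU contDiff_unitPartitionC hf ht hM hD

/-! ### Explicit derivatives: `(ct + d)⁻¹` and `log|ct + d|` -/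

/-- `∂ᵏ (ct + d)⁻¹ = (−1)ᵏ k! cᵏ (ct + d)^{−1−k}` (Mathlib's `iter_deriv_inv_linear`). [folklore] -/
theorem iteratedDeriv_inv_linear (k : ℕ) (c d t : ℝ) :
    iteratedDeriv k (fun s => (c * s + d)⁻¹) t =
      (-1) ^ k * k.factorial * c ^ k * (c * t + d) ^ (-1 - k : ℤ) := by
  rw [iteratedDeriv_eq_iterate, iter_deriv_inv_linear]

/-- `‖∂ᵏ (ct + d)⁻¹‖ ≤ k! |c|ᵏ / |ct + d|^{k+1}` (`ct + d ≠ 0`). [folklore] -/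
theorem norm_iteratedDeriv_inv_linear_le (k : ℕ) (c d t : ℝ) :
    ‖iteratedDeriv k (fun s => (c * s + d)⁻¹) t‖ ≤ k.factorial * |c| ^ k / |c * t + d| ^ (k + 1) := by
  rw [iteratedDeriv_inv_linear, Real.norm_eq_abs]
  rw [show (-1 - k : ℤ) = -((k + 1 : ℕ) : ℤ) by push_cast; ring, zpow_neg, zpow_natCast]
  rw [abs_mul, abs_mul, abs_mul, abs_pow, abs_neg, abs_one, one_pow, one_mul, abs_inv, abs_pow,
    Nat.abs_cast, abs_pow]
  rw [div_eq_mul_inv]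

/-- On the open set `{ct + d ≠ 0}` the function `log|ct + d|` is smooth. [folklore] -/
theorem contDiffOn_log_abs_linear (c d : ℝ) {n : ℕ∞} :
    ContDiffOn ℝ n (fun s => Real.log |c * s + d|) {s | c * s + d ≠ 0} := by
  intro s hs
  have h : (fun s => Real.log |c * s + d|) = fun s => Real.log (c * s + d) := by
    funext r; rw [Real.log_abs]
  rw [h]
  exact ((Real.contDiffAt_log.2 hs).comp s (by fun_prop : ContDiffAt ℝ n (fun s => c * s + d) s)).contDiffWithinAt

/-- `{ct + d ≠ 0}` is open. [folklore] -/
theorem isOpen_linear_ne (c d : ℝ) : IsOpen {s : ℝ | c * s + d ≠ 0} :=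
  isOpen_ne_fun (by fun_prop) continuous_const

/-- The derivative of `log|ct + d|` away from the pole: `c (ct + d)⁻¹`. [folklore] -/
theorem hasDerivAt_log_abs_linear (c d : ℝ) {t : ℝ} (h : c * t + d ≠ 0) :
    HasDerivAt (fun s => Real.log |c * s + d|) (c * (c * t + d)⁻¹) t := by
  have hf : (fun s => Real.log |c * s + d|) = fun s => Real.log (c * s + d) := by
    funext r; rw [Real.log_abs]
  rw [hf]
  have h1 : HasDerivAt (fun s => c * s + d) c t := by
    simpa using ((hasDerivAt_id t).const_mul c).add_const d
  have h2 : HasDerivAt (fun s => Real.log (c * s + d)) (c / (c * t + d)) t :=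
    HasDerivAt.log h1 h
  exact h2.congr_deriv (by rw [div_eq_mul_inv])

/-- Near a point off the pole, `deriv log|ct + d|` agrees with `c (ct + d)⁻¹`. [folklore] -/
theorem deriv_log_abs_linear_eventuallyEq (c d : ℝ) {t : ℝ} (h : c * t + d ≠ 0) :
    deriv (fun s => Real.log |c * s + d|) =ᶠ[nhds t] fun s => c * (c * s + d)⁻¹ := by
  filter_upwards [(isOpen_linear_ne c d).mem_nhds h] with s hs
  exact (hasDerivAt_log_abs_linear c d hs).deriv

/-- **`∂ᵏ⁺¹ log|ct + d| = c · ∂ᵏ (ct + d)⁻¹`** away from the pole. [folklore] -/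
theorem iteratedDeriv_succ_log_abs_linear (k : ℕ) (c d : ℝ) {t : ℝ} (h : c * t + d ≠ 0) :
    iteratedDeriv (k + 1) (fun s => Real.log |c * s + d|) t =
      c * ((-1) ^ k * k.factorial * c ^ k * (c * t + d) ^ (-1 - k : ℤ)) := by
  rw [iteratedDeriv_succ', (deriv_log_abs_linear_eventuallyEq c d h).iteratedDeriv_eq,
    iteratedDeriv_const_mul_field, ← iteratedDeriv_inv_linear]

/-- `‖∂ᵏ⁺¹ log|ct + d|‖ ≤ k! |c|^{k+1}/|ct + d|^{k+1}` away from the pole. [folklore] -/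
theorem norm_iteratedDeriv_log_abs_linear_le (k : ℕ) (c d : ℝ) {t : ℝ} (h : c * t + d ≠ 0) :
    ‖iteratedDeriv (k + 1) (fun s => Real.log |c * s + d|) t‖ ≤
      k.factorial * |c| ^ (k + 1) / |c * t + d| ^ (k + 1) := by
  rw [iteratedDeriv_succ_log_abs_linear k c d h, ← iteratedDeriv_inv_linear, norm_mul,
    Real.norm_eq_abs]
  calc |c| * ‖iteratedDeriv k (fun s => (c * s + d)⁻¹) t‖
      ≤ |c| * (k.factorial * |c| ^ k / |c * t + d| ^ (k + 1)) :=
        mul_le_mul_of_nonneg_left (norm_iteratedDeriv_inv_linear_le k c d t) (abs_nonneg _)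
    _ = _ := by rw [pow_succ]; ring


/-! ### Quadratic polynomials -/

/-- `∂ (p₀ + p₁ s + p₂ s²) = p₁ + 2 p₂ s`. [folklore] -/
theorem deriv_quadratic (p₀ p₁ p₂ : ℝ) :
    deriv (fun s => p₀ + p₁ * s + p₂ * s ^ 2) = fun s => p₁ + 2 * p₂ * s := by
  funext s
  have h : HasDerivAt (fun s => p₀ + p₁ * s + p₂ * s ^ 2) (0 + p₁ * 1 + p₂ * (2 * s)) s := by
    have h1 : HasDerivAt (fun s => p₁ * s) (p₁ * 1) s := (hasDerivAt_id s).const_mul p₁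
    have h2 : HasDerivAt (fun s => p₂ * s ^ 2) (p₂ * (2 * s)) s := by
      simpa using (hasDerivAt_pow 2 s).const_mul p₂
    exact ((hasDerivAt_const s p₀).add h1).add h2
  rw [h.deriv]; ring

/-- `∂² (p₀ + p₁ s + p₂ s²) = 2 p₂`. [folklore] -/
theorem iteratedDeriv_two_quadratic (p₀ p₁ p₂ : ℝ) :
    iteratedDeriv 2 (fun s => p₀ + p₁ * s + p₂ * s ^ 2) = fun _ => 2 * p₂ := by
  rw [show (2 : ℕ) = 1 + 1 from rfl, iteratedDeriv_succ', iteratedDeriv_one, deriv_quadratic]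
  funext s
  have h : HasDerivAt (fun s => p₁ + 2 * p₂ * s) (0 + 2 * p₂ * 1) s :=
    (hasDerivAt_const s p₁).add ((hasDerivAt_id s).const_mul (2 * p₂))
  rw [h.deriv]; ring

/-- `∂^{i+3} (p₀ + p₁ s + p₂ s²) = 0`. [folklore] -/
theorem iteratedDeriv_quadratic_eq_zero (p₀ p₁ p₂ : ℝ) (i : ℕ) :
    iteratedDeriv (i + 3) (fun s => p₀ + p₁ * s + p₂ * s ^ 2) = fun _ => 0 := by
  induction i with
  | zero =>
      rw [show (0 + 3 : ℕ) = 2 + 1 from rfl, iteratedDeriv_succ, iteratedDeriv_two_quadratic]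
      funext s; simp
  | succ i ih =>
      rw [show i + 1 + 3 = (i + 3) + 1 by ring, iteratedDeriv_succ, ih]
      funext s; simp

/-- **Derivative bounds for a quadratic**: if `|p₁ + 2p₂t| ≤ D` and `2|p₂| ≤ D²` then
`‖∂ⁱ q(t)‖ ≤ Dⁱ` for `i ≥ 1`. [folklore] -/
theorem norm_iteratedDeriv_quadratic_le {p₀ p₁ p₂ D t : ℝ} (h1 : |p₁ + 2 * p₂ * t| ≤ D)
    (h2 : 2 * |p₂| ≤ D ^ 2) {i : ℕ} (hi : 1 ≤ i) :
    ‖iteratedDeriv i (fun s => p₀ + p₁ * s + p₂ * s ^ 2) t‖ ≤ D ^ i := by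
  have hD : 0 ≤ D := (abs_nonneg _).trans h1
  rcases Nat.lt_or_ge i 3 with h3 | h3
  · interval_cases i
    · rw [iteratedDeriv_one, deriv_quadratic, Real.norm_eq_abs, pow_one]; exact h1
    · rw [iteratedDeriv_two_quadratic, Real.norm_eq_abs, abs_mul, abs_two]; exact h2
  · obtain ⟨j, rfl⟩ : ∃ j, i = j + 3 := ⟨i - 3, by omega⟩
    rw [iteratedDeriv_quadratic_eq_zero, norm_zero]
    positivity

/-! ### Products -/

/-- **Leibniz bound on an open set**: if `‖f⁽ⁱ⁾(t)‖ ≤ K_f λⁱ` and `‖g⁽ⁱ⁾(t)‖ ≤ K_g λⁱ` for `i ≤ n`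
(`f, g` smooth on an open `U ∋ t`), then `‖(fg)⁽ⁿ⁾(t)‖ ≤ 2ⁿ K_f K_g λⁿ`. [folklore] -/
theorem norm_iteratedDeriv_mul_le_of_isOpen {f g : ℝ → ℂ} {U : Set ℝ} (hU : IsOpen U)
    (hf : ContDiffOn ℝ (⊤ : ℕ∞) f U) (hg : ContDiffOn ℝ (⊤ : ℕ∞) g U) {t : ℝ} (ht : t ∈ U) {n : ℕ}
    {Kf Kg lam : ℝ} (hKf : 0 ≤ Kf) (hlam : 0 ≤ lam)
    (hbf : ∀ i ≤ n, ‖iteratedDeriv i f t‖ ≤ Kf * lam ^ i)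
    (hbg : ∀ i ≤ n, ‖iteratedDeriv i g t‖ ≤ Kg * lam ^ i) :
    ‖iteratedDeriv n (fun s => f s * g s) t‖ ≤ 2 ^ n * Kf * Kg * lam ^ n := by
  have h := norm_iteratedFDerivWithin_mul_le (N := ((⊤ : ℕ∞) : WithTop ℕ∞)) hf hg hU.uniqueDiffOn
    ht (n := n) (by exact_mod_cast le_top)
  rw [(iteratedFDerivWithin_of_isOpen n hU) ht, norm_iteratedFDeriv_eq_norm_iteratedDeriv] at h
  refine h.trans ?_
  calc ∑ i ∈ Finset.range (n + 1), (n.choose i : ℝ) * ‖iteratedFDerivWithin ℝ i f U t‖ *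
          ‖iteratedFDerivWithin ℝ (n - i) g U t‖
      ≤ ∑ i ∈ Finset.range (n + 1), (n.choose i : ℝ) * (Kf * Kg * lam ^ n) := by
        refine Finset.sum_le_sum fun i hi => ?_
        rw [Finset.mem_range] at hi
        rw [(iteratedFDerivWithin_of_isOpen i hU) ht, (iteratedFDerivWithin_of_isOpen (n - i) hU) ht,
          norm_iteratedFDeriv_eq_norm_iteratedDeriv, norm_iteratedFDeriv_eq_norm_iteratedDeriv, mul_assoc]
        refine mul_le_mul_of_nonneg_left ?_ (Nat.cast_nonneg _)
        calc ‖iteratedDeriv i f t‖ * ‖iteratedDeriv (n - i) g t‖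
            ≤ (Kf * lam ^ i) * (Kg * lam ^ (n - i)) :=
              mul_le_mul (hbf i (by omega)) (hbg (n - i) (by omega)) (norm_nonneg _) (by positivity)
          _ = Kf * Kg * (lam ^ i * lam ^ (n - i)) := by ring
          _ = Kf * Kg * lam ^ n := by rw [← pow_add, Nat.add_sub_cancel' (by omega)]
    _ = (∑ i ∈ Finset.range (n + 1), (n.choose i : ℝ)) * (Kf * Kg * lam ^ n) := by
        rw [Finset.sum_mul]
    _ = 2 ^ n * Kf * Kg * lam ^ n := by
        rw [show (∑ i ∈ Finset.range (n + 1), (n.choose i : ℝ)) = ((∑ i ∈ Finset.range (n + 1),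
          n.choose i : ℕ) : ℝ) by push_cast; rfl, Nat.sum_range_choose]
        push_cast; ring

/-! ### B1. The plateau factor -/

section plateau

variable {R : BinQF}

/-- The inner maps of the plateau factor: `f₁(t) = (colA/a − (x − x/Y₁))·Y₁/x` is the quadratic
`p₀ + p₁ t + p₂ t²` with `p₁ = (B u/a)(Y₁/x)`, `p₂ = (C/a)(Y₁/x)`. [folklore] -/
theorem plateauInner₁_eq (R : BinQF) (a : ℤ) (x Y₁ u : ℝ) :
    (fun t => (colA R u t / a - (x - x / Y₁)) * (Y₁ / x)) =
      fun t => ((R.a * u ^ 2 / a - (x - x / Y₁)) * (Y₁ / x)) + (R.b * u / a * (Y₁ / x)) * t +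
        (R.c / a * (Y₁ / x)) * t ^ 2 := by
  funext t; simp only [colA]; ring

/-- The second inner map `f₂(t) = (2x + x/Y₁ − colA/a)·Y₁/x` as a quadratic. [folklore] -/
theorem plateauInner₂_eq (R : BinQF) (a : ℤ) (x Y₁ u : ℝ) :
    (fun t => (2 * x + x / Y₁ - colA R u t / a) * (Y₁ / x)) =
      fun t => ((2 * x + x / Y₁ - R.a * u ^ 2 / a) * (Y₁ / x)) + (-(R.b * u / a * (Y₁ / x))) * t +
        (-(R.c / a * (Y₁ / x))) * t ^ 2 := by
  funext t; simp only [colA]; ring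

/-- The constant of the plateau inner bound: `K₁ = (|B| + 2|C|) c₂/a + 2|C|/a + 1`. [folklore] -/
def plateauConst (R : BinQF) (a : ℤ) (c₂ : ℝ) : ℝ :=
  (|(R.b : ℝ)| + 2 * |(R.c : ℝ)|) * c₂ / a + 2 * |(R.c : ℝ)| / a + 1

/-- `1 ≤ K₁` (`a > 0`, `c₂ ≥ 0`). [folklore] -/
theorem one_le_plateauConst (R : BinQF) {a : ℤ} (ha : 0 < a) {c₂ : ℝ} (hc₂ : 0 ≤ c₂) :
    1 ≤ plateauConst R a c₂ := by
  unfold plateauConst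
  have ha0 : (0 : ℝ) < a := by exact_mod_cast ha
  have : 0 ≤ (|(R.b : ℝ)| + 2 * |(R.c : ℝ)|) * c₂ / a := by positivity
  have : 0 ≤ 2 * |(R.c : ℝ)| / a := by positivity
  linarith

/-- **The inner maps have derivatives `≤ (K₁ Y₁/√x)ⁱ`** on `|u|, |t| ≤ c₂√x` (`x > 0`, `Y₁ ≥ 1`,
`i ≥ 1`). [cite: Ngo2024, §3.1 (`g^{(j)} ≪ (Y₁/x)^j`), §3.5 Lemma 3.17] -/
theorem norm_iteratedDeriv_plateauInner_le (R : BinQF) {a : ℤ} (ha : 0 < a) {x Y₁ : ℝ} (hx : 0 < x)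
    (hY : 1 ≤ Y₁) {c₂ : ℝ} (hc₂ : 0 ≤ c₂) {u t : ℝ} (hu : |u| ≤ c₂ * Real.sqrt x)
    (ht : |t| ≤ c₂ * Real.sqrt x) {i : ℕ} (hi : 1 ≤ i) (σ : ℝ) (hσ : σ = 1 ∨ σ = -1) (p₀ : ℝ) :
    ‖iteratedDeriv i (fun s => p₀ + (σ * (R.b * u / a * (Y₁ / x))) * s +
        (σ * (R.c / a * (Y₁ / x))) * s ^ 2) t‖ ≤
      (plateauConst R a c₂ * Y₁ / Real.sqrt x) ^ i := by
  have ha0 : (0 : ℝ) < a := by exact_mod_cast ha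
  have hsx : 0 < Real.sqrt x := Real.sqrt_pos.2 hx
  have hσ1 : |σ| = 1 := by rcases hσ with rfl | rfl <;> simp
  have hK1 := one_le_plateauConst R ha hc₂
  set K := plateauConst R a c₂ with hKdef
  apply norm_iteratedDeriv_quadratic_le _ _ hi
  · -- `|p₁ + 2 p₂ t| ≤ K Y₁/√x`
    have h1 : |σ * (R.b * u / a * (Y₁ / x)) + 2 * (σ * (R.c / a * (Y₁ / x))) * t| =
        |R.b * u + 2 * R.c * t| / a * (Y₁ / x) := by
      rw [show σ * (R.b * u / a * (Y₁ / x)) + 2 * (σ * (R.c / a * (Y₁ / x))) * t =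
        σ * ((R.b * u + 2 * R.c * t) / a * (Y₁ / x)) by ring, abs_mul, hσ1, one_mul, abs_mul,
        abs_div, abs_of_pos ha0, abs_of_pos (div_pos (by linarith) hx)]
    rw [h1]
    have h2 : |(R.b : ℝ) * u + 2 * R.c * t| ≤ (|(R.b : ℝ)| + 2 * |(R.c : ℝ)|) * (c₂ * Real.sqrt x) := by
      calc |(R.b : ℝ) * u + 2 * R.c * t| ≤ |(R.b : ℝ) * u| + |2 * (R.c : ℝ) * t| := abs_add_le _ _
        _ = |(R.b : ℝ)| * |u| + 2 * |(R.c : ℝ)| * |t| := by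
            rw [abs_mul, abs_mul, abs_mul, abs_two]
        _ ≤ |(R.b : ℝ)| * (c₂ * Real.sqrt x) + 2 * |(R.c : ℝ)| * (c₂ * Real.sqrt x) := by
            gcongr
        _ = _ := by ring
    have e : Real.sqrt x / x = 1 / Real.sqrt x := Real.sqrt_div_self'
    calc |(R.b : ℝ) * u + 2 * R.c * t| / a * (Y₁ / x)
        ≤ (|(R.b : ℝ)| + 2 * |(R.c : ℝ)|) * (c₂ * Real.sqrt x) / a * (Y₁ / x) := by gcongr
      _ = ((|(R.b : ℝ)| + 2 * |(R.c : ℝ)|) * c₂ / a) * Y₁ * (Real.sqrt x / x) := by ring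
      _ = ((|(R.b : ℝ)| + 2 * |(R.c : ℝ)|) * c₂ / a) * Y₁ / Real.sqrt x := by rw [e]; ring
      _ ≤ K * Y₁ / Real.sqrt x := by
          apply div_le_div_of_nonneg_right _ hsx.le
          apply mul_le_mul_of_nonneg_right _ (by linarith)
          rw [hKdef, plateauConst]
          have : 0 ≤ 2 * |(R.c : ℝ)| / a := by positivity
          linarith
  · -- `2|p₂| ≤ (K Y₁/√x)²`
    rw [abs_mul, hσ1, one_mul, abs_mul, abs_div, abs_of_pos ha0,
      abs_of_pos (div_pos (by linarith) hx), div_pow, mul_pow, Real.sq_sqrt hx.le]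
    rw [le_div_iff₀ hx]
    have hK2 : 2 * |(R.c : ℝ)| / a ≤ K := by
      rw [hKdef, plateauConst]
      have : 0 ≤ (|(R.b : ℝ)| + 2 * |(R.c : ℝ)|) * c₂ / a := by positivity
      linarith
    calc 2 * (|(R.c : ℝ)| / a * (Y₁ / x)) * x = (2 * |(R.c : ℝ)| / a) * Y₁ := by field_simp
      _ ≤ K * Y₁ := mul_le_mul_of_nonneg_right hK2 (by linarith)
      _ ≤ K ^ 2 * Y₁ ^ 2 := by
          rw [sq, sq]
          have h3 : K * Y₁ ≤ K * Y₁ * (K * Y₁) := le_mul_of_one_le_right (by positivity)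
            (one_le_mul_of_one_le_of_one_le hK1 hY)
          calc K * Y₁ ≤ K * Y₁ * (K * Y₁) := h3
            _ = K * K * (Y₁ * Y₁) := by ring

/-- **The plateau factor has derivatives `≤ (n+1)! M² (K₁Y₁/√x)ⁿ`**, more precisely
`‖∂ⁿ G_{x,Y₁}(colA(u,t)/a)‖ ≤ 2ⁿ (n! M_Z)² (K₁ Y₁/√x)ⁿ` on `|u|, |t| ≤ c₂√x`.
[cite: Ngo2024, §3.5 Lemma 3.17, §3.6 Lemma 3.20] -/
theorem norm_iteratedDeriv_plateauC_le (R : BinQF) {a : ℤ} (ha : 0 < a) {x Y₁ : ℝ} (hx : 0 < x)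
    (hY : 1 ≤ Y₁) {c₂ : ℝ} (hc₂ : 0 ≤ c₂) {u t : ℝ} (hu : |u| ≤ c₂ * Real.sqrt x)
    (ht : |t| ≤ c₂ * Real.sqrt x) {n : ℕ} {M : ℝ} (hM0 : 0 ≤ M)
    (hM : ∀ i ≤ n, ∀ s : ℝ, ‖iteratedFDeriv ℝ i Real.smoothTransition s‖ ≤ M) :
    ‖iteratedDeriv n (fun s => ((tothPlateau x Y₁ (colA R u s / a) : ℝ) : ℂ)) t‖ ≤
      2 ^ n * (n.factorial * M) * (n.factorial * M) * (plateauConst R a c₂ * Y₁ / Real.sqrt x) ^ n := by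
  set D := plateauConst R a c₂ * Y₁ / Real.sqrt x with hDdef
  have hD0 : 0 ≤ D := by
    rw [hDdef]
    exact div_nonneg (mul_nonneg (zero_le_one.trans (one_le_plateauConst R ha hc₂)) (by linarith))
      (Real.sqrt_nonneg _)
  -- the two factors
  set f₁ : ℝ → ℝ := fun s => ((R.a * u ^ 2 / a - (x - x / Y₁)) * (Y₁ / x)) +
    (1 * (R.b * u / a * (Y₁ / x))) * s + (1 * (R.c / a * (Y₁ / x))) * s ^ 2 with hf₁
  set f₂ : ℝ → ℝ := fun s => ((2 * x + x / Y₁ - R.a * u ^ 2 / a) * (Y₁ / x)) +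
    ((-1) * (R.b * u / a * (Y₁ / x))) * s + ((-1) * (R.c / a * (Y₁ / x))) * s ^ 2 with hf₂
  have hfun : (fun s => ((tothPlateau x Y₁ (colA R u s / a) : ℝ) : ℂ)) =
      fun s => smoothTransitionC (f₁ s) * smoothTransitionC (f₂ s) := by
    funext s
    simp only [tothPlateau, smoothTransitionC, hf₁, hf₂, colA, Complex.ofReal_mul]
    congr 2 <;> ring
  have hZ := norm_iteratedFDeriv_smoothTransitionC_le hM
  have hZ' : ∀ i ≤ n, ∀ s : ℝ, ‖iteratedDeriv i smoothTransitionC s‖ ≤ M := by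
    intro i hi s; rw [← norm_iteratedFDeriv_eq_norm_iteratedDeriv]; exact hZ i hi s
  have hsm : ContDiff ℝ (⊤ : ℕ∞) smoothTransitionC := contDiff_smoothTransitionC
  have hpoly : ∀ (q₀ q₁ q₂ : ℝ), ContDiff ℝ (⊤ : ℕ∞) (fun s : ℝ => q₀ + q₁ * s + q₂ * s ^ 2) := by
    intro q₀ q₁ q₂; fun_prop
  have hb : ∀ (σ : ℝ), (σ = 1 ∨ σ = -1) → ∀ q₀ : ℝ, ∀ j ≤ n,
      ‖iteratedDeriv j (fun s => smoothTransitionC (q₀ + (σ * (R.b * u / a * (Y₁ / x))) * s +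
        (σ * (R.c / a * (Y₁ / x))) * s ^ 2)) t‖ ≤ (n.factorial * M) * D ^ j := by
    intro σ hσ q₀ j hj
    have h := norm_iteratedDeriv_comp_le_of_isOpen (g := smoothTransitionC) isOpen_univ hsm
      ((hpoly q₀ _ _).contDiffOn) (Set.mem_univ t) (n := j) (C := M) (D := D)
      (fun i hi s => hZ' i (hi.trans hj) s)
      (fun i hi1 _ => norm_iteratedDeriv_plateauInner_le R ha hx hY hc₂ hu ht hi1 σ hσ q₀)
    refine h.trans ?_
    have : (j.factorial : ℝ) ≤ n.factorial := by exact_mod_cast Nat.factorial_le hj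
    have hDj : 0 ≤ D ^ j := pow_nonneg hD0 _
    exact mul_le_mul_of_nonneg_right (mul_le_mul_of_nonneg_right this hM0) hDj
  rw [hfun]
  have hc₁ : ContDiffOn ℝ (⊤ : ℕ∞) (fun s => smoothTransitionC (f₁ s)) Set.univ :=
    (hsm.comp (hpoly _ _ _)).contDiffOn
  have hc₂ : ContDiffOn ℝ (⊤ : ℕ∞) (fun s => smoothTransitionC (f₂ s)) Set.univ :=
    (hsm.comp (hpoly _ _ _)).contDiffOn
  exact norm_iteratedDeriv_mul_le_of_isOpen (f := fun s => smoothTransitionC (f₁ s))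
    (g := fun s => smoothTransitionC (f₂ s)) isOpen_univ hc₁ hc₂ (Set.mem_univ t)
    (n := n) (Kf := n.factorial * M) (Kg := n.factorial * M) (lam := D) (by positivity)
    hD0 (hb 1 (Or.inl rfl) _) (hb (-1) (Or.inr rfl) _)

end plateau


/-! ### B2. The phase factor: partial fractions -/

section phase

variable {R : BinQF}

/-- The coefficient of `1/(u − tθ₊)` in the partial-fraction expansion of `colPhi`:
`c₊(u) = ((B − b)θ₊ + 2C)/(2Au(θ₊ − θ₋))`. [folklore] -/
def phiCoefP (R : BinQF) (b : ℤ) (u : ℝ) : ℝ :=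
  (((R.b : ℝ) - b) * rootPlus R + 2 * R.c) / (2 * R.a * u * (rootPlus R - rootMinus R))

/-- The coefficient of `1/(u − tθ₋)`: `c₋(u) = ((B − b)θ₋ + 2C)/(2Au(θ₊ − θ₋))`. [folklore] -/
def phiCoefM (R : BinQF) (b : ℤ) (u : ℝ) : ℝ :=
  (((R.b : ℝ) - b) * rootMinus R + 2 * R.c) / (2 * R.a * u * (rootPlus R - rootMinus R))

/-- **Partial fractions for the Hooley phase**:
`Φ(u,t) = c₊(u)/(u − tθ₊) − c₋(u)/(u − tθ₋)` (`u ≠ 0`, off the two poles).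
[cite: Ngo2024, §3.2 Lemma 3.2] -/
theorem colPhi_eq_partialFractions (hA : R.a ≠ 0) (hΔ : 0 < R.disc) (b : ℤ) {u t : ℝ} (hu : u ≠ 0)
    (hP : u - t * rootPlus R ≠ 0) (hM : u - t * rootMinus R ≠ 0) :
    colPhi R b u t = phiCoefP R b u * (-(rootPlus R) * t + u)⁻¹ -
      phiCoefM R b u * (-(rootMinus R) * t + u)⁻¹ := by
  have hθ : rootPlus R - rootMinus R ≠ 0 := sub_ne_zero.2 (rootPlus_ne_rootMinus hA hΔ)
  have hAr : (R.a : ℝ) ≠ 0 := by exact_mod_cast hA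
  have hP' : -(rootPlus R) * t + u ≠ 0 := by
    rw [show -(rootPlus R) * t + u = u - t * rootPlus R by ring]; exact hP
  have hM' : -(rootMinus R) * t + u ≠ 0 := by
    rw [show -(rootMinus R) * t + u = u - t * rootMinus R by ring]; exact hM
  have hcolA : colA R u t = R.a * ((-(rootPlus R) * t + u) * (-(rootMinus R) * t + u)) := by
    rw [colA_eq_mul hA hΔ.le]; ring
  have h2 : (2 : ℝ) ≠ 0 := two_ne_zero
  have hden1 : 2 * u * (R.a * ((-(rootPlus R) * t + u) * (-(rootMinus R) * t + u))) ≠ 0 :=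
    mul_ne_zero (mul_ne_zero h2 hu) (mul_ne_zero hAr (mul_ne_zero hP' hM'))
  have hden2 : 2 * (R.a * ((-(rootPlus R) * t + u) * (-(rootMinus R) * t + u))) ≠ 0 :=
    mul_ne_zero h2 (mul_ne_zero hAr (mul_ne_zero hP' hM'))
  have hD : 2 * (R.a : ℝ) * u * (rootPlus R - rootMinus R) ≠ 0 :=
    mul_ne_zero (mul_ne_zero (mul_ne_zero h2 hAr) hu) hθ
  have hden3 : 2 * (R.a : ℝ) * u * (rootPlus R - rootMinus R) * (-(rootPlus R) * t + u) ≠ 0 :=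
    mul_ne_zero hD hP'
  have hden4 : 2 * (R.a : ℝ) * u * (rootPlus R - rootMinus R) * (-(rootMinus R) * t + u) ≠ 0 :=
    mul_ne_zero hD hM'
  rw [colPhi, hcolA, phiCoefP, phiCoefM, ← div_eq_mul_inv, ← div_eq_mul_inv, div_div, div_div,
    div_sub_div _ _ hden1 hden2, div_sub_div _ _ hden3 hden4,
    div_eq_div_iff (mul_ne_zero hden1 hden2) (mul_ne_zero hden3 hden4)]
  ring

/-- The size of the partial-fraction coefficients: `K_c = ((|B| + |b|)θ_M + 2|C|)/(2|A|δ)`,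
`θ_M = max(|θ₊|, |θ₋|)`, `δ = |θ₊ − θ₋|`. [folklore] -/
def phiCoefBound (R : BinQF) (b : ℤ) : ℝ :=
  ((|(R.b : ℝ)| + |(b : ℝ)|) * max |rootPlus R| |rootMinus R| + 2 * |(R.c : ℝ)|) /
    (2 * |(R.a : ℝ)| * |rootPlus R - rootMinus R|)

/-- `0 ≤ K_c`. [folklore] -/
theorem phiCoefBound_nonneg (R : BinQF) (b : ℤ) : 0 ≤ phiCoefBound R b := by
  unfold phiCoefBound; positivity

/-- `|c_±(u)| ≤ K_c/|u|`. [folklore] -/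
theorem abs_phiCoef_le (hA : R.a ≠ 0) (hΔ : 0 < R.disc) (b : ℤ) {u : ℝ} (hu : u ≠ 0) (θ : ℝ)
    (hθ : θ = rootPlus R ∨ θ = rootMinus R) :
    |(((R.b : ℝ) - b) * θ + 2 * R.c) / (2 * R.a * u * (rootPlus R - rootMinus R))| ≤
      phiCoefBound R b / |u| := by
  have hδ : 0 < |rootPlus R - rootMinus R| := abs_pos.2 (sub_ne_zero.2 (rootPlus_ne_rootMinus hA hΔ))
  have hA0 : 0 < |(R.a : ℝ)| := abs_pos.2 (by exact_mod_cast hA)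
  have hu0 : 0 < |u| := abs_pos.2 hu
  have hθM : |θ| ≤ max |rootPlus R| |rootMinus R| := by
    rcases hθ with rfl | rfl
    · exact le_max_left _ _
    · exact le_max_right _ _
  rw [abs_div, phiCoefBound, div_div, show |2 * (R.a : ℝ) * u * (rootPlus R - rootMinus R)| =
    2 * |(R.a : ℝ)| * |rootPlus R - rootMinus R| * |u| by
      rw [abs_mul, abs_mul, abs_mul, abs_two]; ring]
  apply div_le_div_of_nonneg_right _ (by positivity)
  calc |((R.b : ℝ) - b) * θ + 2 * R.c| ≤ |((R.b : ℝ) - b) * θ| + |2 * (R.c : ℝ)| := abs_add_le _ _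
    _ = |(R.b : ℝ) - b| * |θ| + 2 * |(R.c : ℝ)| := by rw [abs_mul, abs_mul, abs_two]
    _ ≤ (|(R.b : ℝ)| + |(b : ℝ)|) * max |rootPlus R| |rootMinus R| + 2 * |(R.c : ℝ)| := by
        gcongr
        exact abs_sub _ _

/-- The global partial-fraction function `h (c₊ (−θ₊t + u)⁻¹ − c₋ (−θ₋t + u)⁻¹)`. [folklore] -/
def phasePF (R : BinQF) (b : ℤ) (h : ℤ) (u t : ℝ) : ℝ :=
  h * (phiCoefP R b u * (-(rootPlus R) * t + u)⁻¹ - phiCoefM R b u * (-(rootMinus R) * t + u)⁻¹)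

/-- The open set off the two poles. [folklore] -/
def offPoles (R : BinQF) (u : ℝ) : Set ℝ :=
  {t | -(rootPlus R) * t + u ≠ 0} ∩ {t | -(rootMinus R) * t + u ≠ 0}

/-- `offPoles` is open. [folklore] -/
theorem isOpen_offPoles (R : BinQF) (u : ℝ) : IsOpen (offPoles R u) :=
  (isOpen_linear_ne _ _).inter (isOpen_linear_ne _ _)

/-- Membership in `offPoles` from lower bounds on the root factors. [folklore] -/
theorem mem_offPoles_of_le {u t c : ℝ} (hc : 0 < c) (hP : c ≤ |u - t * rootPlus R|)
    (hM : c ≤ |u - t * rootMinus R|) : t ∈ offPoles R u := by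
  constructor
  · show -(rootPlus R) * t + u ≠ 0
    rw [show -(rootPlus R) * t + u = u - t * rootPlus R by ring]
    intro h0; rw [h0, abs_zero] at hP; linarith
  · show -(rootMinus R) * t + u ≠ 0
    rw [show -(rootMinus R) * t + u = u - t * rootMinus R by ring]
    intro h0; rw [h0, abs_zero] at hM; linarith

/-- Off the poles `colA ≠ 0` (`A ≠ 0`). [folklore] -/
theorem colA_ne_zero_of_mem_offPoles (hA : R.a ≠ 0) (hΔ : 0 < R.disc) {u t : ℝ}
    (ht : t ∈ offPoles R u) : colA R u t ≠ 0 := by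
  obtain ⟨hP, hM⟩ := ht
  have hAr : (R.a : ℝ) ≠ 0 := by exact_mod_cast hA
  rw [colA_eq_mul hA hΔ.le, show u - t * rootPlus R = -(rootPlus R) * t + u by ring,
    show u - t * rootMinus R = -(rootMinus R) * t + u by ring]
  exact mul_ne_zero hAr (mul_ne_zero hP hM)

/-- Near a point off the poles, `h·colPhi` agrees with the partial-fraction function. [folklore] -/
theorem colPhi_eventuallyEq_phasePF (hA : R.a ≠ 0) (hΔ : 0 < R.disc) (b h : ℤ) {u : ℝ} (hu : u ≠ 0)
    {t : ℝ} (ht : t ∈ offPoles R u) :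
    (fun s => (h : ℝ) * colPhi R b u s) =ᶠ[nhds t] fun s => phasePF R b h u s := by
  filter_upwards [(isOpen_offPoles R u).mem_nhds ht] with s hs
  obtain ⟨hP, hM⟩ := hs
  have hP' : u - s * rootPlus R ≠ 0 := by
    rw [show u - s * rootPlus R = -(rootPlus R) * s + u by ring]; exact hP
  have hM' : u - s * rootMinus R ≠ 0 := by
    rw [show u - s * rootMinus R = -(rootMinus R) * s + u by ring]; exact hM
  rw [phasePF, colPhi_eq_partialFractions hA hΔ b hu hP' hM']

/-- `h·colPhi` is smooth off the poles. [folklore] -/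
theorem contDiffOn_colPhi (hA : R.a ≠ 0) (hΔ : 0 < R.disc) (b h : ℤ) {u : ℝ} (hu : u ≠ 0)
    {n : ℕ∞} : ContDiffOn ℝ n (fun s => (h : ℝ) * colPhi R b u s) (offPoles R u) :=
  fun _ ht => (contDiffAt_const.mul
    (contDiffAt_colPhi R b hu (colA_ne_zero_of_mem_offPoles hA hΔ ht))).contDiffWithinAt

/-- `(cs + d)⁻¹` is smooth at points off its pole. [folklore] -/
theorem contDiffAt_inv_linear {c d t : ℝ} (h : c * t + d ≠ 0) {n : ℕ∞} :
    ContDiffAt ℝ n (fun s => (c * s + d)⁻¹) t :=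
  ContDiffAt.inv (by fun_prop) h

/-- **The derivatives of `h·Φ` off the poles**:
`∂ⁱ(hΦ)(t) = h (c₊ ∂ⁱ(−θ₊s + u)⁻¹ − c₋ ∂ⁱ(−θ₋s + u)⁻¹)`. [folklore] -/
theorem iteratedDeriv_colPhi (hA : R.a ≠ 0) (hΔ : 0 < R.disc) (b h : ℤ) {u : ℝ} (hu : u ≠ 0)
    {t : ℝ} (ht : t ∈ offPoles R u) (i : ℕ) :
    iteratedDeriv i (fun s => (h : ℝ) * colPhi R b u s) t =
      h * (phiCoefP R b u * iteratedDeriv i (fun s => (-(rootPlus R) * s + u)⁻¹) t -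
        phiCoefM R b u * iteratedDeriv i (fun s => (-(rootMinus R) * s + u)⁻¹) t) := by
  rw [(colPhi_eventuallyEq_phasePF hA hΔ b h hu ht).iteratedDeriv_eq]
  have hfun : (fun s => phasePF R b h u s) = fun s => (h : ℝ) *
      ((fun s => phiCoefP R b u * (-(rootPlus R) * s + u)⁻¹) s -
        (fun s => phiCoefM R b u * (-(rootMinus R) * s + u)⁻¹) s) := by
    funext s; rfl
  rw [hfun, iteratedDeriv_const_mul_field]
  congr 1
  have h1 : ContDiffAt ℝ i (fun s => phiCoefP R b u * (-(rootPlus R) * s + u)⁻¹) t :=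
    contDiffAt_const.mul (contDiffAt_inv_linear ht.1)
  have h2 : ContDiffAt ℝ i (fun s => phiCoefM R b u * (-(rootMinus R) * s + u)⁻¹) t :=
    contDiffAt_const.mul (contDiffAt_inv_linear ht.2)
  rw [show (fun s => (fun s => phiCoefP R b u * (-(rootPlus R) * s + u)⁻¹) s -
      (fun s => phiCoefM R b u * (-(rootMinus R) * s + u)⁻¹) s) =
      (fun s => phiCoefP R b u * (-(rootPlus R) * s + u)⁻¹) -
        fun s => phiCoefM R b u * (-(rootMinus R) * s + u)⁻¹ from rfl,
    iteratedDeriv_sub h1 h2, iteratedDeriv_const_mul_field, iteratedDeriv_const_mul_field]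

/-- `i! ≤ nⁱ` for `i ≤ n`. [folklore] -/
theorem factorial_le_pow_of_le {i n : ℕ} (hin : i ≤ n) : (i.factorial : ℝ) ≤ (n : ℝ) ^ i := by
  have h1 : i.factorial ≤ i ^ i := Nat.factorial_le_pow i
  have h2 : i ^ i ≤ n ^ i := Nat.pow_le_pow_left hin i
  exact_mod_cast h1.trans h2

/-- **Bound for the derivatives of `h·Φ` on the good region**: with `|u − tθ±| ≥ c₁√x`,
`|u| ≥ c₀√x`, `|h| ≤ C_h x`: `‖∂ⁱ(hΦ)(t)‖ ≤ Dⁱ` for `1 ≤ i ≤ n`, where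
`D = max(1, 2C_hK_c/(c₀c₁)) · n · (θ_M/c₁) / √x`.  (Ngo: the phase derivatives cost `≪ x^{-1/2}`
each, uniformly in `h ≤ x`.) [cite: Ngo2024, §3.2 Lemma 3.2, §3.5 Lemma 3.17] -/
theorem norm_iteratedDeriv_colPhi_le (hA : R.a ≠ 0) (hΔ : 0 < R.disc) (b : ℤ) {x : ℝ} (hx : 0 < x)
    {h : ℤ} {Ch : ℝ} (hCh : 0 ≤ Ch) (hh : |(h : ℝ)| ≤ Ch * x) {c₀ c₁ : ℝ} (hc₀ : 0 < c₀) (hc₁ : 0 < c₁)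
    {u t : ℝ} (hu : c₀ * Real.sqrt x ≤ |u|) (hP : c₁ * Real.sqrt x ≤ |u - t * rootPlus R|)
    (hM : c₁ * Real.sqrt x ≤ |u - t * rootMinus R|) {n i : ℕ} (hi : 1 ≤ i) (hin : i ≤ n) :
    ‖iteratedDeriv i (fun s => (h : ℝ) * colPhi R b u s) t‖ ≤
      (max 1 (2 * Ch * phiCoefBound R b / (c₀ * c₁)) * n * (max |rootPlus R| |rootMinus R| / c₁) /
        Real.sqrt x) ^ i := by
  have hsx : 0 < Real.sqrt x := Real.sqrt_pos.2 hx
  have hu0 : u ≠ 0 := by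
    intro h0; rw [h0, abs_zero] at hu; have := mul_pos hc₀ hsx; linarith
  have ht : t ∈ offPoles R u := mem_offPoles_of_le (mul_pos hc₁ hsx) hP hM
  set θM := max |rootPlus R| |rootMinus R| with hθM
  set Kc := phiCoefBound R b with hKc
  have hKc0 : 0 ≤ Kc := phiCoefBound_nonneg R b
  have hθM0 : 0 ≤ θM := le_max_of_le_left (abs_nonneg _)
  rw [iteratedDeriv_colPhi hA hΔ b h hu0 ht i, norm_mul, Real.norm_eq_abs]
  -- the two inverse-linear terms
  have hinv : ∀ θ : ℝ, (θ = rootPlus R ∨ θ = rootMinus R) → c₁ * Real.sqrt x ≤ |u - t * θ| →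
      |(((R.b : ℝ) - b) * θ + 2 * R.c) / (2 * R.a * u * (rootPlus R - rootMinus R)) *
        iteratedDeriv i (fun s => (-θ * s + u)⁻¹) t| ≤
        (Kc / |u|) * (i.factorial * θM ^ i / (c₁ * Real.sqrt x) ^ (i + 1)) := by
    intro θ hθ hθt
    rw [abs_mul]
    have h1 := abs_phiCoef_le hA hΔ b hu0 θ hθ
    have h2 : |iteratedDeriv i (fun s => (-θ * s + u)⁻¹) t| ≤
        i.factorial * θM ^ i / (c₁ * Real.sqrt x) ^ (i + 1) := by
      have h3 := norm_iteratedDeriv_inv_linear_le i (-θ) u t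
      rw [Real.norm_eq_abs] at h3
      refine h3.trans ?_
      have hθle : |(-θ)| ≤ θM := by
        rw [abs_neg]; rcases hθ with rfl | rfl
        · exact le_max_left _ _
        · exact le_max_right _ _
      have hden : (c₁ * Real.sqrt x) ^ (i + 1) ≤ |(-θ) * t + u| ^ (i + 1) := by
        apply pow_le_pow_left₀ (by positivity)
        rwa [show -θ * t + u = u - t * θ by ring]
      have hpos : 0 < (c₁ * Real.sqrt x) ^ (i + 1) := by positivity
      calc (i.factorial : ℝ) * |(-θ)| ^ i / |(-θ) * t + u| ^ (i + 1)
          ≤ (i.factorial : ℝ) * θM ^ i / |(-θ) * t + u| ^ (i + 1) := by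
            apply div_le_div_of_nonneg_right _ (by positivity)
            exact mul_le_mul_of_nonneg_left (pow_le_pow_left₀ (abs_nonneg _) hθle i) (by positivity)
        _ ≤ (i.factorial : ℝ) * θM ^ i / (c₁ * Real.sqrt x) ^ (i + 1) :=
            div_le_div_of_nonneg_left (by positivity) hpos hden
    exact mul_le_mul h1 h2 (abs_nonneg _) (by positivity)
  have hPt := hinv (rootPlus R) (Or.inl rfl) hP
  have hMt := hinv (rootMinus R) (Or.inr rfl) hM
  simp only [phiCoefP, phiCoefM]
  -- combine
  have hsum : |(((R.b : ℝ) - b) * rootPlus R + 2 * R.c) / (2 * R.a * u * (rootPlus R - rootMinus R)) *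
        iteratedDeriv i (fun s => (-rootPlus R * s + u)⁻¹) t -
      (((R.b : ℝ) - b) * rootMinus R + 2 * R.c) / (2 * R.a * u * (rootPlus R - rootMinus R)) *
        iteratedDeriv i (fun s => (-rootMinus R * s + u)⁻¹) t| ≤
      2 * ((Kc / |u|) * (i.factorial * θM ^ i / (c₁ * Real.sqrt x) ^ (i + 1))) := by
    refine (abs_sub _ _).trans ?_
    linarith
  refine (mul_le_mul hh hsum (abs_nonneg _) (by positivity)).trans ?_
  -- `Ch x · 2 (Kc/|u|) i! θM^i/(c₁√x)^{i+1} ≤ D^i`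
  have hux : Kc / |u| ≤ Kc / (c₀ * Real.sqrt x) :=
    div_le_div_of_nonneg_left hKc0 (mul_pos hc₀ hsx) hu
  have hfac : (i.factorial : ℝ) ≤ (n : ℝ) ^ i := factorial_le_pow_of_le hin
  set K₀ := 2 * Ch * Kc / (c₀ * c₁) with hK₀
  have hK₀0 : 0 ≤ K₀ := by rw [hK₀]; positivity
  have hmax1 : 1 ≤ max 1 K₀ := le_max_left _ _
  have hK₀le : K₀ ≤ (max 1 K₀) ^ i := by
    calc K₀ ≤ max 1 K₀ := le_max_right _ _
      _ = (max 1 K₀) ^ 1 := (pow_one _).symm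
      _ ≤ (max 1 K₀) ^ i := pow_le_pow_right₀ hmax1 hi
  obtain ⟨r, hr0, hr⟩ : ∃ r : ℝ, 0 < r ∧ Real.sqrt x = r := ⟨_, hsx, rfl⟩
  have hxr : x = r ^ 2 := by rw [← hr, Real.sq_sqrt hx.le]
  rw [hr] at hux ⊢
  rw [hxr]
  calc Ch * r ^ 2 * (2 * (Kc / |u| * (i.factorial * θM ^ i / (c₁ * r) ^ (i + 1))))
      ≤ Ch * r ^ 2 * (2 * (Kc / (c₀ * r) * ((n : ℝ) ^ i * θM ^ i / (c₁ * r) ^ (i + 1)))) := by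
        gcongr
    _ = K₀ * ((n : ℝ) * (θM / c₁) / r) ^ i := by
        have e1 : ((n : ℝ) * (θM / c₁) / r) ^ i = (n : ℝ) ^ i * θM ^ i / (c₁ * r) ^ i := by
          rw [show (n : ℝ) * (θM / c₁) / r = ((n : ℝ) * θM) / (c₁ * r) by field_simp, div_pow,
            mul_pow (n : ℝ) θM i]
        have e2 : (c₁ * r) ^ (i + 1) = (c₁ * r) ^ i * (c₁ * r) := pow_succ _ _
        rw [hK₀, e1, e2]
        obtain ⟨Q, hQ0, hQ⟩ : ∃ Q : ℝ, 0 < Q ∧ (c₁ * r) ^ i = Q := ⟨_, by positivity, rfl⟩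
        rw [hQ]
        field_simp
    _ ≤ (max 1 K₀) ^ i * ((n : ℝ) * (θM / c₁) / r) ^ i :=
        mul_le_mul_of_nonneg_right hK₀le (by positivity)
    _ = (max 1 K₀ * n * (θM / c₁) / r) ^ i := by
        rw [← mul_pow]; congr 1; ring

end phase

/-! ### B3. The `ψ` factor -/

section psi

variable {R : BinQF}

/-- The global log-coordinate function `(log|−θ₊s + u| − log|−θ₋s + u|)/L − m`. [folklore] -/
def psiInner (R : BinQF) (L : ℝ) (m : ℤ) (u t : ℝ) : ℝ :=
  -(m : ℝ) + L⁻¹ * (Real.log |-(rootPlus R) * t + u| - Real.log |-(rootMinus R) * t + u|)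

/-- Off the poles, `log|colK|/L − m` is the log-coordinate function. [folklore] -/
theorem colPsi_arg_eq_psiInner {L : ℝ} {m : ℤ} {u t : ℝ} (ht : t ∈ offPoles R u) :
    Real.log |colK R u t| / L - m = psiInner R L m u t := by
  obtain ⟨hP, hM⟩ := ht
  rw [psiInner, colK, abs_div, show u - t * rootPlus R = -(rootPlus R) * t + u by ring,
    show u - t * rootMinus R = -(rootMinus R) * t + u by ring,
    Real.log_div (abs_ne_zero.2 hP) (abs_ne_zero.2 hM)]
  ring

/-- Near a point off the poles, the `ψ` factor is `β_ℂ ∘ psiInner`. [folklore] -/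
theorem colPsiC_eventuallyEq {L : ℝ} {m : ℤ} {u t : ℝ} (ht : t ∈ offPoles R u) :
    (fun s => ((colPsi R L m u s : ℝ) : ℂ)) =ᶠ[nhds t] fun s => unitPartitionC (psiInner R L m u s) := by
  filter_upwards [(isOpen_offPoles R u).mem_nhds ht] with s hs
  rw [colPsi, colPsi_arg_eq_psiInner hs, unitPartitionC]

/-- `psiInner` is smooth off the poles. [folklore] -/
theorem contDiffOn_psiInner (R : BinQF) (L : ℝ) (m : ℤ) (u : ℝ) {n : ℕ∞} :
    ContDiffOn ℝ n (fun s => psiInner R L m u s) (offPoles R u) := by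
  intro t ht
  unfold psiInner
  apply ContDiffWithinAt.add contDiffWithinAt_const
  apply ContDiffWithinAt.mul contDiffWithinAt_const
  exact ((contDiffOn_log_abs_linear _ _ t ht.1).mono Set.inter_subset_left).sub
    ((contDiffOn_log_abs_linear _ _ t ht.2).mono Set.inter_subset_right)

/-- **The derivatives of the log-coordinate off the poles** (`i ≥ 1`):
`∂ⁱ psiInner = L⁻¹ (∂ⁱ log|−θ₊s + u| − ∂ⁱ log|−θ₋s + u|)`. [folklore] -/
theorem iteratedDeriv_psiInner (R : BinQF) (L : ℝ) (m : ℤ) {u t : ℝ} (ht : t ∈ offPoles R u)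
    {i : ℕ} (hi : 1 ≤ i) :
    iteratedDeriv i (fun s => psiInner R L m u s) t =
      L⁻¹ * (iteratedDeriv i (fun s => Real.log |-(rootPlus R) * s + u|) t -
        iteratedDeriv i (fun s => Real.log |-(rootMinus R) * s + u|) t) := by
  have hfun : (fun s => psiInner R L m u s) = fun s => -(m : ℝ) + (fun s => L⁻¹ *
      ((fun s => Real.log |-(rootPlus R) * s + u|) s - (fun s => Real.log |-(rootMinus R) * s + u|) s)) s := by
    funext s; rfl
  rw [hfun, iteratedDeriv_const_add (by omega), iteratedDeriv_const_mul_field]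
  congr 1
  have h1 : ContDiffAt ℝ i (fun s => Real.log |-(rootPlus R) * s + u|) t :=
    (contDiffOn_log_abs_linear _ _).contDiffAt ((isOpen_linear_ne _ _).mem_nhds ht.1)
  have h2 : ContDiffAt ℝ i (fun s => Real.log |-(rootMinus R) * s + u|) t :=
    (contDiffOn_log_abs_linear _ _).contDiffAt ((isOpen_linear_ne _ _).mem_nhds ht.2)
  rw [show (fun s => (fun s => Real.log |-(rootPlus R) * s + u|) s -
      (fun s => Real.log |-(rootMinus R) * s + u|) s) =
      (fun s => Real.log |-(rootPlus R) * s + u|) - fun s => Real.log |-(rootMinus R) * s + u| from rfl,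
    iteratedDeriv_sub h1 h2]

/-- **Bound for the derivatives of the log-coordinate on the good region**: with
`|u − tθ±| ≥ c₁√x`: `‖∂ⁱ psiInner(t)‖ ≤ Dⁱ` for `1 ≤ i ≤ n`, where
`D = max(1, 2/L) · n · (θ_M/c₁) / √x`. [cite: Ngo2024, §3.4 Lemma 3.11, §3.5 Lemma 3.17] -/
theorem norm_iteratedDeriv_psiInner_le (R : BinQF) {L : ℝ} (hL : 0 < L) (m : ℤ) {x : ℝ} (hx : 0 < x)
    {c₁ : ℝ} (hc₁ : 0 < c₁) {u t : ℝ} (hP : c₁ * Real.sqrt x ≤ |u - t * rootPlus R|)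
    (hM : c₁ * Real.sqrt x ≤ |u - t * rootMinus R|) {n i : ℕ} (hi : 1 ≤ i) (hin : i ≤ n) :
    ‖iteratedDeriv i (fun s => psiInner R L m u s) t‖ ≤
      (max 1 (2 / L) * n * (max |rootPlus R| |rootMinus R| / c₁) / Real.sqrt x) ^ i := by
  have hsx : 0 < Real.sqrt x := Real.sqrt_pos.2 hx
  have ht : t ∈ offPoles R u := mem_offPoles_of_le (mul_pos hc₁ hsx) hP hM
  set θM := max |rootPlus R| |rootMinus R| with hθM
  have hθM0 : 0 ≤ θM := le_max_of_le_left (abs_nonneg _)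
  obtain ⟨k, rfl⟩ : ∃ k, i = k + 1 := ⟨i - 1, by omega⟩
  rw [iteratedDeriv_psiInner R L m ht hi, Real.norm_eq_abs, abs_mul, abs_inv, abs_of_pos hL]
  have hlog : ∀ θ : ℝ, (θ = rootPlus R ∨ θ = rootMinus R) → c₁ * Real.sqrt x ≤ |u - t * θ| →
      |iteratedDeriv (k + 1) (fun s => Real.log |-θ * s + u|) t| ≤
        k.factorial * θM ^ (k + 1) / (c₁ * Real.sqrt x) ^ (k + 1) := by
    intro θ hθ hθt
    have hne : -θ * t + u ≠ 0 := by
      rw [show -θ * t + u = u - t * θ by ring]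
      intro h0; rw [h0, abs_zero] at hθt; have := mul_pos hc₁ hsx; linarith
    have h3 := norm_iteratedDeriv_log_abs_linear_le k (-θ) u hne
    rw [Real.norm_eq_abs] at h3
    refine h3.trans ?_
    have hθle : |(-θ)| ≤ θM := by
      rw [abs_neg]; rcases hθ with rfl | rfl
      · exact le_max_left _ _
      · exact le_max_right _ _
    have hden : (c₁ * Real.sqrt x) ^ (k + 1) ≤ |(-θ) * t + u| ^ (k + 1) := by
      apply pow_le_pow_left₀ (by positivity)
      rwa [show -θ * t + u = u - t * θ by ring]
    have hpos : 0 < (c₁ * Real.sqrt x) ^ (k + 1) := by positivity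
    calc (k.factorial : ℝ) * |(-θ)| ^ (k + 1) / |(-θ) * t + u| ^ (k + 1)
        ≤ (k.factorial : ℝ) * θM ^ (k + 1) / |(-θ) * t + u| ^ (k + 1) := by
          apply div_le_div_of_nonneg_right _ (by positivity)
          exact mul_le_mul_of_nonneg_left (pow_le_pow_left₀ (abs_nonneg _) hθle _) (by positivity)
      _ ≤ _ := div_le_div_of_nonneg_left (by positivity) hpos hden
  have hPt := hlog (rootPlus R) (Or.inl rfl) hP
  have hMt := hlog (rootMinus R) (Or.inr rfl) hM
  have hsum : |iteratedDeriv (k + 1) (fun s => Real.log |-rootPlus R * s + u|) t -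
      iteratedDeriv (k + 1) (fun s => Real.log |-rootMinus R * s + u|) t| ≤
      2 * (k.factorial * θM ^ (k + 1) / (c₁ * Real.sqrt x) ^ (k + 1)) := by
    refine (abs_sub _ _).trans ?_
    linarith
  refine (mul_le_mul_of_nonneg_left hsum (by positivity)).trans ?_
  have hfac : (k.factorial : ℝ) ≤ (n : ℝ) ^ (k + 1) := by
    have h1 : (k.factorial : ℝ) ≤ ((k + 1).factorial : ℝ) := by
      exact_mod_cast Nat.factorial_le (Nat.le_succ k)
    exact h1.trans (factorial_le_pow_of_le hin)
  set K₀ := 2 / L with hK₀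
  have hmax1 : 1 ≤ max 1 K₀ := le_max_left _ _
  have hK₀le : K₀ ≤ (max 1 K₀) ^ (k + 1) := by
    calc K₀ ≤ max 1 K₀ := le_max_right _ _
      _ = (max 1 K₀) ^ 1 := (pow_one _).symm
      _ ≤ (max 1 K₀) ^ (k + 1) := pow_le_pow_right₀ hmax1 hi
  calc L⁻¹ * (2 * ((k.factorial : ℝ) * θM ^ (k + 1) / (c₁ * Real.sqrt x) ^ (k + 1)))
      ≤ L⁻¹ * (2 * ((n : ℝ) ^ (k + 1) * θM ^ (k + 1) / (c₁ * Real.sqrt x) ^ (k + 1))) := by gcongr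
    _ = K₀ * ((n : ℝ) * (θM / c₁) / Real.sqrt x) ^ (k + 1) := by
        rw [hK₀, show (n : ℝ) * (θM / c₁) / Real.sqrt x = ((n : ℝ) * θM) / (c₁ * Real.sqrt x) by
          field_simp, div_pow, mul_pow]
        ring
    _ ≤ (max 1 K₀) ^ (k + 1) * ((n : ℝ) * (θM / c₁) / Real.sqrt x) ^ (k + 1) :=
        mul_le_mul_of_nonneg_right hK₀le (by positivity)
    _ = (max 1 K₀ * n * (θM / c₁) / Real.sqrt x) ^ (k + 1) := by
        rw [← mul_pow]; congr 1; ring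

end psi


/-! ### B4. The column function -/

section column

variable {R : BinQF}

/-- `(M/√x)ʲ ≤ (max 1 M)ⁿ (Y₁/√x)ʲ` for `0 ≤ M`, `1 ≤ Y₁`, `j ≤ n`. [folklore] -/
theorem div_sqrt_pow_le {M x Y₁ : ℝ} (hM : 0 ≤ M) (hx : 0 < x) (hY : 1 ≤ Y₁) {j n : ℕ} (hjn : j ≤ n) :
    (M / Real.sqrt x) ^ j ≤ (max 1 M) ^ n * (Y₁ / Real.sqrt x) ^ j := by
  have hsx : 0 < Real.sqrt x := Real.sqrt_pos.2 hx
  calc (M / Real.sqrt x) ^ j = M ^ j * (1 / Real.sqrt x) ^ j := by rw [← mul_pow]; ring_nf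
    _ ≤ (max 1 M) ^ n * (Y₁ / Real.sqrt x) ^ j := by
        apply mul_le_mul _ _ (by positivity) (by positivity)
        · exact (pow_le_pow_left₀ hM (le_max_right _ _) j).trans
            (pow_le_pow_right₀ (le_max_left _ _) hjn)
        · exact pow_le_pow_left₀ (by positivity) (div_le_div_of_nonneg_right hY hsx.le) j

/-- Near a point off the poles, `colFn` is the product of its three factors. [folklore] -/
theorem colFn_eventuallyEq_prod (hA : R.a ≠ 0) (hΔ : 0 < R.disc) (a b : ℤ) (x Y₁ : ℝ) (h : ℤ)
    (L : ℝ) (m : ℤ) {u t : ℝ} (ht : t ∈ offPoles R u) :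
    (fun s => colFn R a b x Y₁ h L m u s) =ᶠ[nhds t] fun s =>
      ((tothPlateau x Y₁ (colA R u s / a) : ℝ) : ℂ) * ex (h * colPhi R b u s) *
        ((colPsi R L m u s : ℝ) : ℂ) := by
  filter_upwards [(isOpen_offPoles R u).mem_nhds ht] with s hs
  rw [colFn, if_neg (colA_ne_zero_of_mem_offPoles hA hΔ hs)]

/-- The `ψ` factor is smooth off the poles. [folklore] -/
theorem contDiffOn_colPsiC (R : BinQF) (L : ℝ) (m : ℤ) (u : ℝ) {n : ℕ∞} :
    ContDiffOn ℝ n (fun s => ((colPsi R L m u s : ℝ) : ℂ)) (offPoles R u) := by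
  intro t ht
  have hP : u - t * rootPlus R ≠ 0 := by
    rw [show u - t * rootPlus R = -(rootPlus R) * t + u by ring]; exact ht.1
  have hM : u - t * rootMinus R ≠ 0 := by
    rw [show u - t * rootMinus R = -(rootMinus R) * t + u by ring]; exact ht.2
  exact (Complex.ofRealCLM.contDiff.contDiffAt.comp t (contDiffAt_colPsi R L m hP hM)).contDiffWithinAt

/-- The explicit constant of the derivative bound for `colFn`. [folklore] -/
def colFnDerivConst (R : BinQF) (a b : ℤ) (L : ℝ) (n : ℕ) (Ch c₀ c₁ c₂ MZ Mβ : ℝ) : ℝ :=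
  2 ^ n * (2 ^ n * (2 ^ n * (n.factorial * MZ) * (n.factorial * MZ) * plateauConst R a c₂ ^ n) *
    (n.factorial * (2 * Real.pi) ^ n *
      (max 1 (max 1 (2 * Ch * phiCoefBound R b / (c₀ * c₁)) * n *
        (max |rootPlus R| |rootMinus R| / c₁))) ^ n)) *
    (n.factorial * Mβ * (max 1 (max 1 (2 / L) * n * (max |rootPlus R| |rootMinus R| / c₁))) ^ n)

/-- **Derivative bound for the column function on the good region**: for `x > 0`, `Y₁ ≥ 1`,
`|h| ≤ C_h x`, `c₀√x ≤ |u| ≤ c₂√x`, `|t| ≤ c₂√x`, `|u − tθ±| ≥ c₁√x`: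
`‖∂ⁿ_t colFn(u, t)‖ ≤ C · (Y₁/√x)ⁿ` with `C = colFnDerivConst …` independent of `x, Y₁, h, u, t`.
[cite: Ngo2024, §3.5 Lemma 3.17, §3.6 Lemma 3.20] -/
theorem norm_iteratedDeriv_colFn_le_of_good (hA : R.a ≠ 0) (hΔ : 0 < R.disc) {a : ℤ} (ha : 0 < a)
    (b : ℤ) {x Y₁ : ℝ} (hx : 0 < x) (hY1 : 1 ≤ Y₁) {h : ℤ} {Ch : ℝ} (hCh : 0 ≤ Ch)
    (hh : |(h : ℝ)| ≤ Ch * x) {L : ℝ} (hL : 0 < L) (m : ℤ) {c₀ c₁ c₂ : ℝ} (hc₀ : 0 < c₀)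
    (hc₁ : 0 < c₁) (hc₂ : 0 ≤ c₂) {u t : ℝ} (hu0 : c₀ * Real.sqrt x ≤ |u|)
    (huc : |u| ≤ c₂ * Real.sqrt x) (htc : |t| ≤ c₂ * Real.sqrt x)
    (hP : c₁ * Real.sqrt x ≤ |u - t * rootPlus R|) (hM : c₁ * Real.sqrt x ≤ |u - t * rootMinus R|)
    {n : ℕ} {MZ : ℝ} (hMZ0 : 0 ≤ MZ)
    (hMZ : ∀ i ≤ n, ∀ s : ℝ, ‖iteratedFDeriv ℝ i Real.smoothTransition s‖ ≤ MZ)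
    {Mβ : ℝ} (hMβ0 : 0 ≤ Mβ) (hMβ : ∀ i ≤ n, ∀ s : ℝ, ‖iteratedDeriv i unitPartitionC s‖ ≤ Mβ) :
    ‖iteratedDeriv n (fun s => colFn R a b x Y₁ h L m u s) t‖ ≤
      colFnDerivConst R a b L n Ch c₀ c₁ c₂ MZ Mβ * (Y₁ / Real.sqrt x) ^ n := by
  have hsx : 0 < Real.sqrt x := Real.sqrt_pos.2 hx
  have hu : u ≠ 0 := by
    intro h0; rw [h0, abs_zero] at hu0; have := mul_pos hc₀ hsx; linarith
  have ht : t ∈ offPoles R u := mem_offPoles_of_le (mul_pos hc₁ hsx) hP hM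
  set lam := Y₁ / Real.sqrt x with hlam
  have hlam0 : 0 ≤ lam := by positivity
  set θM := max |rootPlus R| |rootMinus R| with hθM
  have hθM0 : 0 ≤ θM := le_max_of_le_left (abs_nonneg _)
  set K₁ := plateauConst R a c₂ with hK₁
  have hK₁1 : 1 ≤ K₁ := one_le_plateauConst R ha hc₂
  set M₂ := max 1 (2 * Ch * phiCoefBound R b / (c₀ * c₁)) * n * (θM / c₁) with hM₂
  have hM₂0 : 0 ≤ M₂ := by rw [hM₂]; positivity
  set M₃ := max 1 (2 / L) * n * (θM / c₁) with hM₃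
  have hM₃0 : 0 ≤ M₃ := by rw [hM₃]; positivity
  set KP := 2 ^ n * (n.factorial * MZ) * (n.factorial * MZ) * K₁ ^ n with hKP
  set KE := n.factorial * (2 * Real.pi) ^ n * (max 1 M₂) ^ n with hKE
  set KΨ := n.factorial * Mβ * (max 1 M₃) ^ n with hKΨ
  have hKP0 : 0 ≤ KP := by rw [hKP]; positivity
  have hKE0 : 0 ≤ KE := by rw [hKE]; positivity
  have hKΨ0 : 0 ≤ KΨ := by rw [hKΨ]; positivity
  have hgoal : colFnDerivConst R a b L n Ch c₀ c₁ c₂ MZ Mβ = 2 ^ n * (2 ^ n * KP * KE) * KΨ := by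
    rw [colFnDerivConst, hKP, hKE, hKΨ, hM₂, hM₃, hθM, hK₁]
  rw [hgoal]
  -- the three factors
  set Pf : ℝ → ℂ := fun s => ((tothPlateau x Y₁ (colA R u s / a) : ℝ) : ℂ) with hPf
  set Ef : ℝ → ℂ := fun s => ex (h * colPhi R b u s) with hEf
  set Ψf : ℝ → ℂ := fun s => ((colPsi R L m u s : ℝ) : ℂ) with hΨf
  have hPon : ContDiffOn ℝ (⊤ : ℕ∞) Pf (offPoles R u) :=
    (Complex.ofRealCLM.contDiff.comp ((contDiff_tothPlateau x Y₁).comp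
      ((contDiff_colA R u).div_const _))).contDiffOn
  have hEon : ContDiffOn ℝ (⊤ : ℕ∞) Ef (offPoles R u) :=
    contDiff_ex.comp_contDiffOn (contDiffOn_colPhi hA hΔ b h hu)
  have hΨon : ContDiffOn ℝ (⊤ : ℕ∞) Ψf (offPoles R u) := contDiffOn_colPsiC R L m u
  -- (F1) plateau
  have hF1 : ∀ j ≤ n, ‖iteratedDeriv j Pf t‖ ≤ KP * lam ^ j := by
    intro j hj
    have h1 := norm_iteratedDeriv_plateauC_le R ha hx hY1 hc₂ huc htc (n := j) hMZ0
      (fun i hi s => hMZ i (hi.trans hj) s)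
    refine h1.trans ?_
    rw [← hK₁, show (K₁ * Y₁ / Real.sqrt x) ^ j = K₁ ^ j * lam ^ j by
      rw [hlam, ← mul_pow, mul_div_assoc]]
    have e1 : (2 : ℝ) ^ j ≤ 2 ^ n := pow_le_pow_right₀ (by norm_num) hj
    have e2 : (j.factorial : ℝ) * MZ ≤ n.factorial * MZ :=
      mul_le_mul_of_nonneg_right (by exact_mod_cast Nat.factorial_le hj) hMZ0
    have e3 : K₁ ^ j ≤ K₁ ^ n := pow_le_pow_right₀ hK₁1 hj
    rw [hKP]
    have : (2 : ℝ) ^ j * (j.factorial * MZ) * (j.factorial * MZ) * K₁ ^ j ≤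
        2 ^ n * (n.factorial * MZ) * (n.factorial * MZ) * K₁ ^ n := by
      apply mul_le_mul _ e3 (by positivity) (by positivity)
      apply mul_le_mul _ e2 (by positivity) (by positivity)
      exact mul_le_mul e1 e2 (by positivity) (by positivity)
    calc (2 : ℝ) ^ j * (j.factorial * MZ) * (j.factorial * MZ) * (K₁ ^ j * lam ^ j)
        = (2 : ℝ) ^ j * (j.factorial * MZ) * (j.factorial * MZ) * K₁ ^ j * lam ^ j := by ring
      _ ≤ _ := mul_le_mul_of_nonneg_right this (by positivity)
  -- (F2) phase
  have hF2 : ∀ j ≤ n, ‖iteratedDeriv j Ef t‖ ≤ KE * lam ^ j := by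
    intro j hj
    have h1 := norm_iteratedDeriv_ex_comp_le (isOpen_offPoles R u) (contDiffOn_colPhi hA hΔ b h hu)
      ht (n := j) (D := M₂ / Real.sqrt x)
      (fun i hi1 hij => norm_iteratedDeriv_colPhi_le hA hΔ b hx hCh hh hc₀ hc₁ hu0 hP hM hi1
        (hij.trans hj))
    refine h1.trans ?_
    have e1 : (j.factorial : ℝ) * (2 * Real.pi) ^ j ≤ n.factorial * (2 * Real.pi) ^ n :=
      mul_le_mul (by exact_mod_cast Nat.factorial_le hj)
        (pow_le_pow_right₀ (by linarith [Real.pi_gt_three]) hj) (by positivity) (by positivity)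
    have e2 := div_sqrt_pow_le hM₂0 hx hY1 hj (Y₁ := Y₁)
    rw [hKE]
    calc (j.factorial : ℝ) * (2 * Real.pi) ^ j * (M₂ / Real.sqrt x) ^ j
        ≤ (n.factorial * (2 * Real.pi) ^ n) * ((max 1 M₂) ^ n * (Y₁ / Real.sqrt x) ^ j) :=
          mul_le_mul e1 e2 (by positivity) (by positivity)
      _ = _ := by rw [hlam]; ring
  -- (F3) psi
  have hF3 : ∀ j ≤ n, ‖iteratedDeriv j Ψf t‖ ≤ KΨ * lam ^ j := by
    intro j hj
    rw [hΨf, (colPsiC_eventuallyEq (L := L) (m := m) ht).iteratedDeriv_eq]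
    have h1 := norm_iteratedDeriv_unitPartitionC_comp_le (isOpen_offPoles R u)
      (contDiffOn_psiInner R L m u) ht (n := j) (M := Mβ) (D := M₃ / Real.sqrt x)
      (fun i hi s => hMβ i (hi.trans hj) s)
      (fun i hi1 hij => norm_iteratedDeriv_psiInner_le R hL m hx hc₁ hP hM hi1 (hij.trans hj))
    refine h1.trans ?_
    have e1 : (j.factorial : ℝ) * Mβ ≤ n.factorial * Mβ :=
      mul_le_mul_of_nonneg_right (by exact_mod_cast Nat.factorial_le hj) hMβ0
    have e2 := div_sqrt_pow_le hM₃0 hx hY1 hj (Y₁ := Y₁)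
    rw [hKΨ]
    calc (j.factorial : ℝ) * Mβ * (M₃ / Real.sqrt x) ^ j
        ≤ (n.factorial * Mβ) * ((max 1 M₃) ^ n * (Y₁ / Real.sqrt x) ^ j) :=
          mul_le_mul e1 e2 (by positivity) (by positivity)
      _ = _ := by rw [hlam]; ring
  -- first product
  have hF12 : ∀ j ≤ n, ‖iteratedDeriv j (fun s => Pf s * Ef s) t‖ ≤ (2 ^ n * KP * KE) * lam ^ j := by
    intro j hj
    have h1 := norm_iteratedDeriv_mul_le_of_isOpen (isOpen_offPoles R u) hPon hEon ht (n := j)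
      hKP0 hlam0 (fun i hi => hF1 i (hi.trans hj)) (fun i hi => hF2 i (hi.trans hj))
    refine h1.trans ?_
    have e1 : (2 : ℝ) ^ j ≤ 2 ^ n := pow_le_pow_right₀ (by norm_num) hj
    have : (2 : ℝ) ^ j * KP * KE ≤ 2 ^ n * KP * KE :=
      mul_le_mul_of_nonneg_right (mul_le_mul_of_nonneg_right e1 hKP0) hKE0
    exact mul_le_mul_of_nonneg_right this (by positivity)
  -- second product
  have h2 := norm_iteratedDeriv_mul_le_of_isOpen (isOpen_offPoles R u) (hPon.mul hEon) hΨon ht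
    (n := n) (by positivity) hlam0 hF12 hF3
  rw [(colFn_eventuallyEq_prod hA hΔ a b x Y₁ h L m ht).iteratedDeriv_eq]
  exact h2

/-- `0 ≤ colFnDerivConst` (for `a > 0`, `c₂ ≥ 0`, `MZ, Mβ ≥ 0`). [folklore] -/
theorem colFnDerivConst_nonneg (R : BinQF) {a : ℤ} (ha : 0 < a) (b : ℤ) (L : ℝ) (n : ℕ)
    (Ch c₀ c₁ : ℝ) {c₂ MZ Mβ : ℝ} (hc₂ : 0 ≤ c₂) (hMZ : 0 ≤ MZ) (hMβ : 0 ≤ Mβ) :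
    0 ≤ colFnDerivConst R a b L n Ch c₀ c₁ c₂ MZ Mβ := by
  unfold colFnDerivConst
  have h1 : 0 ≤ plateauConst R a c₂ := zero_le_one.trans (one_le_plateauConst R ha hc₂)
  set K₁ := plateauConst R a c₂
  set A₂ := max 1 (max 1 (2 * Ch * phiCoefBound R b / (c₀ * c₁)) * n *
      (max |rootPlus R| |rootMinus R| / c₁)) with hA₂
  set A₃ := max 1 (max 1 (2 / L) * n * (max |rootPlus R| |rootMinus R| / c₁)) with hA₃
  have h2 : 0 ≤ A₂ := le_max_of_le_left zero_le_one
  have h3 : 0 ≤ A₃ := le_max_of_le_left zero_le_one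
  positivity

/-- **Derivative bound for the column function** (all `t`): for `|u| ≥ c₀√x` there is `C`
(depending on `R, a, b, L, m, n, C_h, c₀` only) with `‖∂ⁿ_t colFn(u,t)‖ ≤ C (Y₁/√x)ⁿ` for all
`x > 0`, `Y₁ ≥ 2`, `|h| ≤ C_h x`.  Off the topological support the derivative vanishes; on it the
good-region bound applies. [cite: Ngo2024, §3.5 Lemma 3.17, §3.6 Lemma 3.20] -/
theorem exists_norm_iteratedDeriv_colFn_le (hA : R.a ≠ 0) (hΔ : 0 < R.disc) {a : ℤ} (ha : 0 < a)
    (b : ℤ) {L : ℝ} (hL : 0 < L) (m : ℤ) (n : ℕ) {Ch c₀ : ℝ} (hCh : 0 ≤ Ch) (hc₀ : 0 < c₀) :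
    ∃ C : ℝ, 0 ≤ C ∧ ∀ (x Y₁ : ℝ) (h : ℤ) (u t : ℝ), 0 < x → 2 ≤ Y₁ → |(h : ℝ)| ≤ Ch * x →
      c₀ * Real.sqrt x ≤ |u| →
        ‖iteratedDeriv n (fun s => colFn R a b x Y₁ h L m u s) t‖ ≤ C * (Y₁ / Real.sqrt x) ^ n := by
  obtain ⟨c₁, c₂, hc₁, hc₁₂, hc⟩ := exists_colFn_support_consts hA hΔ ha hL m
  have hc₂ : 0 ≤ c₂ := hc₁.le.trans hc₁₂
  obtain ⟨MZ, hMZ1, hMZ⟩ := exists_bound_iteratedFDeriv_smoothTransition n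
  obtain ⟨Mβ, hMβ1, hMβ⟩ := exists_bound_iteratedDeriv_unitPartitionC n
  have hMZ0 : 0 ≤ MZ := zero_le_one.trans hMZ1
  have hMβ0 : 0 ≤ Mβ := zero_le_one.trans hMβ1
  have hC0 := colFnDerivConst_nonneg R ha b L n Ch c₀ c₁ hc₂ hMZ0 hMβ0
  refine ⟨colFnDerivConst R a b L n Ch c₀ c₁ c₂ MZ Mβ, hC0, ?_⟩
  intro x Y₁ h u t hx hY hh hu0
  have hY1 : 1 ≤ Y₁ := by linarith
  have hsx : 0 < Real.sqrt x := Real.sqrt_pos.2 hx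
  by_cases htt : t ∈ tsupport (fun s => colFn R a b x Y₁ h L m u s)
  · -- on the topological support: the good region
    have hne : (Function.support fun s => colFn R a b x Y₁ h L m u s).Nonempty := by
      by_contra hemp
      rw [Set.not_nonempty_iff_eq_empty] at hemp
      rw [tsupport, hemp, closure_empty] at htt
      exact htt
    obtain ⟨s₀, hs₀⟩ := hne
    have huc : |u| ≤ c₂ * Real.sqrt x := (hc b x Y₁ h u s₀ hx hY hs₀).2.2.2
    -- the closed good region contains the support, hence the topological support
    set G : Set ℝ := {s | c₁ * Real.sqrt x ≤ |u - s * rootPlus R|} ∩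
      {s | c₁ * Real.sqrt x ≤ |u - s * rootMinus R|} ∩ {s | |s| ≤ c₂ * Real.sqrt x} with hG
    have hGc : IsClosed G := by
      apply IsClosed.inter (IsClosed.inter _ _) _
      · exact isClosed_le continuous_const (by fun_prop)
      · exact isClosed_le continuous_const (by fun_prop)
      · exact isClosed_le (by fun_prop) continuous_const
    have hsub : (Function.support fun s => colFn R a b x Y₁ h L m u s) ⊆ G := by
      intro s hs
      obtain ⟨⟨h1, -⟩, ⟨h2, -⟩, h3, -⟩ := hc b x Y₁ h u s hx hY hs
      exact ⟨⟨h1, h2⟩, h3⟩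
    have htG : t ∈ G := (closure_minimal hsub hGc) htt
    obtain ⟨⟨hP, hM⟩, htc⟩ := htG
    exact norm_iteratedDeriv_colFn_le_of_good hA hΔ ha b hx hY1 hCh hh hL m hc₀ hc₁ hc₂ hu0 huc htc
      hP hM hMZ0 hMZ hMβ0 hMβ
  · -- off the topological support the function vanishes near `t`
    have h0 : iteratedDeriv n (fun s => colFn R a b x Y₁ h L m u s) t = 0 := by
      rw [(notMem_tsupport_iff_eventuallyEq.1 htt).iteratedDeriv_eq]
      show iteratedDeriv n (fun _ : ℝ => (0 : ℂ)) t = 0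
      rw [iteratedDeriv_const]
      split_ifs <;> rfl
    rw [h0, norm_zero]
    positivity

end column


/-! ### B5. The `L¹` bound -/

section L1

variable {R : BinQF}

/-- `L¹` norm of a function bounded by `M` and supported in `[a, b]`. [folklore] -/
theorem integral_norm_le_of_support_subset {g : ℝ → ℂ} {a b M : ℝ} (hab : a ≤ b)
    (hsupp : Function.support g ⊆ Set.Icc a b) (hM : ∀ t, ‖g t‖ ≤ M) :
    ∫ t, ‖g t‖ ≤ M * (b - a) := by
  have hzero : ∀ t, t ∉ Set.Icc a b → ‖g t‖ = 0 := by
    intro t ht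
    rw [norm_eq_zero]
    by_contra h
    exact ht (hsupp (Function.mem_support.mpr h))
  rw [← MeasureTheory.setIntegral_eq_integral_of_forall_compl_eq_zero (s := Set.Icc a b) hzero]
  have h1 : ‖∫ t in Set.Icc a b, ‖g t‖‖ ≤ M * (MeasureTheory.volume.real (Set.Icc a b)) :=
    MeasureTheory.norm_setIntegral_le_of_norm_le_const measure_Icc_lt_top
      (fun t _ => by rw [norm_norm]; exact hM t)
  rw [Real.volume_real_Icc_of_le hab] at h1
  exact (Real.le_norm_self _).trans h1

/-- The support of a derivative lies in the topological support. [folklore] -/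
theorem support_iteratedDeriv_subset_tsupport {g : ℝ → ℂ} (n : ℕ) :
    Function.support (iteratedDeriv n g) ⊆ tsupport g := by
  intro t ht
  apply support_iteratedFDeriv_subset (𝕜 := ℝ) n
  rw [Function.mem_support] at ht ⊢
  intro h0
  apply ht
  rw [iteratedDeriv_eq_iteratedFDeriv, h0]
  rfl

/-- **`L¹` bound for the derivatives of the column function**: for `|u| ≥ c₀√x`,
`∫ ‖∂ⁿ_t colFn(u,t)‖ dt ≤ C (Y₁/√x)ⁿ √x` (derivative bound × length `≪ √x` of the support).
[cite: Ngo2024, §3.5 Lemma 3.16] -/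
theorem exists_integral_norm_iteratedDeriv_colFn_le (hA : R.a ≠ 0) (hΔ : 0 < R.disc) {a : ℤ}
    (ha : 0 < a) (b : ℤ) {L : ℝ} (hL : 0 < L) (m : ℤ) (n : ℕ) {Ch c₀ : ℝ} (hCh : 0 ≤ Ch)
    (hc₀ : 0 < c₀) :
    ∃ C : ℝ, 0 ≤ C ∧ ∀ (x Y₁ : ℝ) (h : ℤ) (u : ℝ), 0 < x → 2 ≤ Y₁ → |(h : ℝ)| ≤ Ch * x →
      c₀ * Real.sqrt x ≤ |u| →
        ∫ t, ‖iteratedDeriv n (fun s => colFn R a b x Y₁ h L m u s) t‖ ≤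
          C * (Y₁ / Real.sqrt x) ^ n * Real.sqrt x := by
  obtain ⟨C₁, hC₁0, hC₁⟩ := exists_norm_iteratedDeriv_colFn_le hA hΔ ha b hL m n hCh hc₀
  obtain ⟨c₁, c₂, hc₁, hc₁₂, hc⟩ := exists_colFn_support_consts hA hΔ ha hL m
  have hc₂ : 0 ≤ c₂ := hc₁.le.trans hc₁₂
  refine ⟨2 * c₂ * C₁, by positivity, ?_⟩
  intro x Y₁ h u hx hY hh hu0
  have hsx : 0 ≤ Real.sqrt x := Real.sqrt_nonneg x
  -- the support of the derivative lies in `[-c₂√x, c₂√x]`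
  have hsupp0 : (Function.support fun s => colFn R a b x Y₁ h L m u s) ⊆
      Set.Icc (-(c₂ * Real.sqrt x)) (c₂ * Real.sqrt x) := by
    intro t ht
    have := (hc b x Y₁ h u t hx hY ht).2.2.1
    exact Set.mem_Icc.2 (abs_le.1 this)
  have hts : tsupport (fun s => colFn R a b x Y₁ h L m u s) ⊆
      Set.Icc (-(c₂ * Real.sqrt x)) (c₂ * Real.sqrt x) := closure_minimal hsupp0 isClosed_Icc
  have hsupp : Function.support (iteratedDeriv n fun s => colFn R a b x Y₁ h L m u s) ⊆
      Set.Icc (-(c₂ * Real.sqrt x)) (c₂ * Real.sqrt x) :=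
    (support_iteratedDeriv_subset_tsupport n).trans hts
  have hb := integral_norm_le_of_support_subset (by linarith [mul_nonneg hc₂ hsx]) hsupp
    (fun t => hC₁ x Y₁ h u t hx hY hh hu0)
  refine hb.trans (le_of_eq ?_)
  ring

end L1

end RootForms

end Literature.NumberTheory.Sieve
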